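import Literature.NumberTheory.Automorphic.InvariantIntegralOperators
import Literature.NumberTheory.Sieve.QuadraticRootsLevelGeometry
import Literature.NumberTheory.Sieve.QuadraticRootsPrimeModuliDFIGamma0Domain
import Literature.NumberTheory.Sieve.GrimmeltMerikoski2025
import Literature.NumberTheory.Sieve.GrimmeltMerikoski2025Technical
import Literature.NumberTheory.Sieve.GrimmeltMerikoski2025HeegnerKernel
import HarnessLib

/-!
# Grimmelt–Merikoski 2025: Lemma 3.1 (Heegner points and orbit sums) and the kernel side of §4–5

L. Grimmelt, J. Merikoski, *On the greatest prime factor and uniform equidistribution of quadratic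
polynomials*, arXiv:2505.00493 [GrimmeltMerikoski2025].  This file is the bridge between the
arithmetic objects of Theorem 1.4 (the named fact
`Literature.NumberTheory.Sieve.grimmeltMerikoski2025_thm14_restricted`) and the automorphic objects of
the hypothesis schema `GM2025.TechnicalDatum` (`GrimmeltMerikoski2025Technical.lean`, the content of
[GrimmeltMerikoski2025, Theorem 2.1] = [GMtechnical, Thm 8.1]).  Everything here is PROVED.

* **Part 1–3 (Lemma 3.1 of the paper, `sum_rootSum_eq_sum_forms`, `sum_forms_eq_sum_heegPairs`).**
  The smoothed count `∑_{k ≡ 0 (d)} ψ₁(k/K) ∑_{aℓ² + h ≡ 0 (k)} ψ₂(ℓ/X')` equals a sum over the level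
  forms `[ak, 2aℓ, m]` of discriminant `−4ah` (`klForm`, the tree's `RootForms` correspondence of
  `QuadraticRootsLevel{Forms,Cosets,Classes,Geometry}.lean`), and then — choosing canonical
  Lagrange-reduced representatives `lrep` of the classes (`repsCan`), a left transversal
  `leftTrans q` of `Γ₀(q)` in `SL₂(ℤ)` (`q = ad`), and the Heegner data
  `heegPairs a h d = {(R, τ) : R·τ of level ad, middle coefficient ≡ 0 (2a)}` with points
  `pairPt (R, τ) = τ⁻¹·z_R` and weights `pairWt = |stab R|⁻¹` — the weighted sum of orbit sums
  `∑_p pairWt p · orbitSum Γ₀(ad) φ (pairPt p)` of the test function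
  `φ = skewTestFun ψ₁ (ψ₂(−·)) (X'/K) (√(ah)/(aK))` (`formWeight_eq_skewTestFun`): this is the
  identity "`∑_k ψ₁(k/K) ∑_ℓ ψ₂(ℓ/X_j) = ⟨I|𝒦_{ad} F_j|α_{d,a,h}⟩`" of §5 of the paper with the
  functional (5.2).
* **Part 4 (`integral_skewTestFun_xStretch`).** `∫_ℍ skewTestFun Ψ₁ Ψ₂ (c·sX) sY = c ∫_ℍ skewTestFun Ψ₁ Ψ₂ sX sY`
  (the substitution `x ↦ cx` on `dx dy/y²`), which makes the main terms of the two scales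
  `X₁ = X`, `X₂` cancel ("the corresponding integrals … match exactly").
* **Part 5 (kernel side).** `automorphicKernel_iPt_eq_kernelDiagSum`: `⟨I|𝒦_q k⁺_Z|I⟩` at the
  skewed base point `i·sX` is the arithmetic diagonal sum `kernelDiagSum` of
  `GrimmeltMerikoski2025KernelDiagonal.lean` (Proposition 4.2); `pointPairInv_heegnerPt`:
  `u(z_Q, z_R) = uPair`; and `kernelSide_le`: the first display of the proof of Proposition 4.1 —
  `∑_{p,p'} b_p b_{p'} 𝒦_{Γ₀(q)} k⁺_Z(w_{p'}, w_p) ≤ ∑_{t ∈ Λ} ∑_{s ∈ 𝒮} k⁺_Z(u(z_s, z_t)) · levelWeight_q(s, t)`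
  (orbit unfolding `γ ↦ g = τγτ'⁻¹` over `SL₂(ℤ)`, at most one transversal element per coset,
  common level coset ⇒ `q ∣ Res` by the resultant identities `Res·x³, Res·y³ ∈ (P(x,y), P'(x,y))`,
  the level-coset count `card_levelCosets_le_sum`), whose right-hand side is the summand of
  `heegnerKernel_sum_le` (`GrimmeltMerikoski2025HeegnerKernel.lean`).

## References

* [GrimmeltMerikoski2025] L. Grimmelt, J. Merikoski, arXiv:2505.00493, Lemma 3.1, §4.1, §5.
* [DukeFriedlanderIwaniec1995] W. Duke, J. Friedlander, H. Iwaniec, Ann. of Math. 141 (1995), §2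
  (the forms–roots correspondence, level cosets).
-/

noncomputable section

namespace Literature.NumberTheory.Sieve

open UpperHalfPlane MeasureTheory Finset
open Literature.NumberTheory.Automorphic (pointPairInv automorphicKernel)
open Literature.NumberTheory.Sieve.DFI1995 (Gamma0GL)
open Literature.NumberTheory.QuadraticFields.Quadratic (BinQF)
open scoped MatrixGroups ContDiff

namespace GM2025


/-! ## Lemma 3.1 bridge, part 1: the smoothed count over `(k, ℓ)` as a sum over level forms -/

section bridgeForms

open RootForms

/-- The form `[ak, 2aℓ, (aℓ² + h)/k]` attached to a modulus `k` and an integer root `ℓ` of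
`aℓ² + h ≡ 0 (mod k)` — GM's symmetric matrix `(𝔞, 𝔟, 𝔠) = (m, aℓ, ak)` of determinant `ah`
([GrimmeltMerikoski2025, §3.1]) read as the binary form `[𝔠, 2𝔟, 𝔞]` of discriminant `−4ah`.
[cite: GrimmeltMerikoski2025, §3.1 (S_{a,h}(d) ↔ {(m,ℓ,k)})] -/
def klForm (a h : ℕ) (p : ℕ × ℤ) : BinQF := ⟨(a : ℤ) * p.1, 2 * (a : ℤ) * p.2, ((a : ℤ) * p.2 ^ 2 + h) / p.1⟩

/-- The weight of a form: `Φ(Q) = ψ₁(A/(aK)) ψ₂(B/(2aX'))`, so that `Φ([ak, 2aℓ, ·]) = ψ₁(k/K)ψ₂(ℓ/X')`.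
[cite: GrimmeltMerikoski2025, §3.1 ("F(m,ℓ,k) = F(𝔞, 𝔟/a, 𝔠/a)") and §5 (F_{⋄,j})] -/
def formWeight (a : ℕ) (ψ₁ ψ₂ : ℝ → ℂ) (K X' : ℝ) (Q : BinQF) : ℂ :=
  ψ₁ ((Q.a : ℝ) / (a * K)) * ψ₂ ((Q.b : ℝ) / (2 * a * X'))

/-- `klForm` is injective (`a ≠ 0`). [folklore] -/
theorem klForm_injective {a : ℕ} (ha : 0 < a) (h : ℕ) : Function.Injective (klForm a h) := by
  intro p p' hpp'
  simp only [klForm, BinQF.mk.injEq] at hpp'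
  have ha' : (a : ℤ) ≠ 0 := by exact_mod_cast ha.ne'
  refine Prod.ext ?_ ?_
  · have := mul_left_cancel₀ ha' hpp'.1
    exact_mod_cast this
  · have : (2 * (a : ℤ)) * p.2 = (2 * (a : ℤ)) * p'.2 := by linarith [hpp'.2.1]
    exact mul_left_cancel₀ (by positivity) this

/-- The weight of `klForm (k, ℓ)` is `ψ₁(k/K) ψ₂(ℓ/X')`. [folklore] -/
theorem formWeight_klForm {a : ℕ} (ha : 0 < a) (h : ℕ) (ψ₁ ψ₂ : ℝ → ℂ) {K X' : ℝ} (hK : 0 < K)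
    (hX : 0 < X') (p : ℕ × ℤ) :
    formWeight a ψ₁ ψ₂ K X' (klForm a h p) = ψ₁ ((p.1 : ℝ) / K) * ψ₂ ((p.2 : ℝ) / X') := by
  have ha' : (0 : ℝ) < a := by exact_mod_cast ha
  unfold formWeight klForm
  push_cast
  congr 2
  · field_simp
  · field_simp

/-- **The smoothed count over `(k, ℓ)` is a sum over forms**: for `a ≥ 1`,
`∑_{k ≤ N_k, d ∣ k} ψ₁(k/K) ∑_{|ℓ| ≤ ⌈X'⌉, k ∣ aℓ²+h} ψ₂(ℓ/X') = ∑_{Q} Φ(Q)`, `Q` over the forms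
`klForm (k, ℓ)` of these pairs. [cite: GrimmeltMerikoski2025, §3.1 and Lemma 3.1] -/
theorem sum_rootSum_eq_sum_forms {a : ℕ} (ha : 0 < a) (h d Nk : ℕ) (ψ₁ ψ₂ : ℝ → ℂ) {K X' : ℝ}
    (hK : 0 < K) (hX : 0 < X') :
    ∑ k ∈ (Icc 1 Nk).filter (d ∣ ·), ψ₁ ((k : ℝ) / K) * rootSum a h k ψ₂ X' =
      ∑ Q ∈ ((((Icc 1 Nk).filter (d ∣ ·)) ×ˢ (Icc (-(⌈X'⌉ : ℤ)) ⌈X'⌉)).filter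
          (fun p : ℕ × ℤ => (p.1 : ℤ) ∣ (a : ℤ) * p.2 ^ 2 + (h : ℤ))).image (klForm a h),
        formWeight a ψ₁ ψ₂ K X' Q := by
  rw [sum_image fun p _ p' _ hpp' => klForm_injective ha h hpp']
  conv_rhs => rw [sum_filter, sum_product]
  refine sum_congr rfl fun k _ => ?_
  unfold rootSum
  rw [mul_sum, sum_filter]
  refine sum_congr rfl fun ℓ _ => ?_
  split_ifs with hdvd
  · rw [formWeight_klForm ha h ψ₁ ψ₂ hK hX]
  · rfl

/-- Membership in the form set: exactly the level forms `X(a, 0, −4ah; ad)` with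
`0 < A ≤ aN_k` and `|B| ≤ 2a⌈X'⌉`. [cite: GrimmeltMerikoski2025, §3.1 (S_{a,h}(d))] -/
theorem mem_image_klForm_iff {a : ℕ} (ha : 0 < a) {h d Nk : ℕ} {X' : ℝ} {Q : BinQF} :
    Q ∈ ((((Icc 1 Nk).filter (d ∣ ·)) ×ˢ (Icc (-(⌈X'⌉ : ℤ)) ⌈X'⌉)).filter
          (fun p : ℕ × ℤ => (p.1 : ℤ) ∣ (a : ℤ) * p.2 ^ 2 + (h : ℤ))).image (klForm a h) ↔
      IsLevelForm a 0 (-(4 * (a : ℤ) * h)) (a * d) Q ∧ 0 < Q.a ∧ Q.a ≤ (a : ℤ) * Nk ∧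
        |Q.b| ≤ 2 * (a : ℤ) * ⌈X'⌉ := by
  have ha' : (0 : ℤ) < a := by exact_mod_cast ha
  constructor
  · rintro hQ
    rw [mem_image] at hQ
    obtain ⟨⟨k, ℓ⟩, hp, rfl⟩ := hQ
    rw [mem_filter, mem_product, mem_filter, mem_Icc, mem_Icc] at hp
    obtain ⟨⟨⟨⟨hk1, hkN⟩, hdk⟩, hℓ⟩, hdvd⟩ := hp
    obtain ⟨m, hm⟩ := hdvd
    have hk0 : (0 : ℤ) < k := by exact_mod_cast hk1
    have hC : ((a : ℤ) * ℓ ^ 2 + h) / k = m := by rw [hm, Int.mul_ediv_cancel_left _ hk0.ne']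
    refine ⟨⟨?_, ?_, ?_⟩, ?_, ?_, ?_⟩
    · simp only [klForm, BinQF.disc, hC]
      have : (k : ℤ) * m = (a : ℤ) * ℓ ^ 2 + h := hm.symm
      nlinarith [this]
    · simp only [klForm]
      push_cast
      exact mul_dvd_mul_left _ (Int.natCast_dvd_natCast.mpr hdk)
    · simp only [klForm, sub_zero]
      exact ⟨ℓ, by ring⟩
    · simp only [klForm]; positivity
    · simp only [klForm]
      exact mul_le_mul_of_nonneg_left (by exact_mod_cast hkN) ha'.le
    · simp only [klForm]
      rw [abs_mul, abs_of_pos (by positivity : (0 : ℤ) < 2 * a)]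
      exact mul_le_mul_of_nonneg_left (abs_le.mpr hℓ) (by positivity)
  · rintro ⟨hlev, hA, hAN, hB⟩
    obtain ⟨k, hk⟩ : (a : ℤ) ∣ Q.a := (dvd_mul_right (a : ℤ) d).trans (by exact_mod_cast hlev.level_dvd)
    obtain ⟨ℓ, hℓ⟩ := hlev.mid_dvd
    rw [sub_zero] at hℓ
    have hk0 : 0 < k := by rw [hk] at hA; exact pos_of_mul_pos_right hA ha'.le
    have hdisc := hlev.disc_eq
    rw [BinQF.disc, hk, hℓ] at hdisc
    -- `4a · (k C − aℓ² − h) = 0`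
    have hkC : k * Q.c = (a : ℤ) * ℓ ^ 2 + h := by nlinarith [hdisc]
    refine mem_image.mpr ⟨(k.toNat, ℓ), ?_, ?_⟩
    · have hkcast : ((k.toNat : ℕ) : ℤ) = k := Int.toNat_of_nonneg hk0.le
      rw [mem_filter, mem_product, mem_filter, mem_Icc, mem_Icc]
      refine ⟨⟨⟨⟨by omega, ?_⟩, ?_⟩, ?_⟩, ?_⟩
      · have : k ≤ Nk := by nlinarith [hAN, hk]
        omega
      · have hq := hlev.level_dvd
        rw [hk] at hq
        push_cast at hq
        have : (d : ℤ) ∣ k := Int.dvd_of_mul_dvd_mul_left ha'.ne' hq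
        rw [← hkcast] at this
        exact Int.natCast_dvd_natCast.mp this
      · rw [hℓ, abs_mul, abs_of_pos (by positivity : (0 : ℤ) < 2 * a)] at hB
        exact abs_le.mp (le_of_mul_le_mul_left hB (by positivity))
      · simp only [hkcast]
        exact ⟨Q.c, by rw [hkC]⟩
    · have hkcast : ((k.toNat : ℕ) : ℤ) = k := Int.toNat_of_nonneg hk0.le
      simp only [klForm, hkcast]
      cases Q with
      | mk A B C =>
        simp only at hk hℓ hkC ⊢
        simp only [BinQF.mk.injEq]
        refine ⟨hk.symm, hℓ.symm, ?_⟩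
        rw [← hkC, Int.mul_ediv_cancel_left _ hk0.ne']

end bridgeForms

/-! ## Part 2: the weight as a function of the Heegner point -/

section bridgeHeegner

open RootForms

/-- `Im z_Q = √(−Δ)/(2A)`. [cite: DukeFriedlanderIwaniec1995, §2 p. 427] -/
theorem heegnerPt_im' {Q : BinQF} (hA : 0 < Q.a) (hΔ : Q.disc < 0) :
    (heegnerPt Q hA hΔ).im = Real.sqrt (-(Q.disc : ℝ)) / (2 * Q.a) := by
  rw [← UpperHalfPlane.coe_im, coe_heegnerPt, Complex.div_ofReal_im]
  simp

/-- `Re z_Q = −B/(2A)`. [cite: DukeFriedlanderIwaniec1995, §2 p. 427] -/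
theorem heegnerPt_re' {Q : BinQF} (hA : 0 < Q.a) (hΔ : Q.disc < 0) :
    (heegnerPt Q hA hΔ).re = -(Q.b : ℝ) / (2 * Q.a) := by
  rw [← UpperHalfPlane.coe_re, coe_heegnerPt, Complex.div_ofReal_re]
  simp

/-- **The weight is the test function at the Heegner point**: for a form of discriminant `−4ah`
with `A > 0`, `Φ(Q) = φ(z_Q)` with `φ = skewTestFun ψ₁ (ψ₂(−·)) (X'/K) (√(ah)/(aK))`
(`Im z_Q = √(ah)/A`, `Re z_Q = −B/(2A)`; cf. [GrimmeltMerikoski2025, §5]: `F_{⋄,j}(𝔤) = ψ₁(𝔠√(ah)/(aK)) ψ₂(𝔟√(ah)/(aX_j))`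
with Iwasawa coordinates `y = 1/𝔠`, `x = 𝔟/𝔠`, supports `𝐘 = √(h/a)/K`, `𝐗_j = X_j/K`).
[cite: GrimmeltMerikoski2025, §5 (definition of F_{⋄,j} and the scales 𝐗_j, 𝐘)] -/
theorem formWeight_eq_skewTestFun {a h : ℕ} (ha : 0 < a) (hh : 0 < h) (ψ₁ ψ₂ : ℝ → ℂ) {K X' : ℝ}
    (hK : 0 < K) (hX : 0 < X') {Q : BinQF} (hA : 0 < Q.a) (hdisc : Q.disc = -(4 * (a : ℤ) * h)) :
    formWeight a ψ₁ ψ₂ K X' Q =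
      skewTestFun ψ₁ (fun s => ψ₂ (-s)) (X' / K) (Real.sqrt ((a * h : ℕ) : ℝ) / (a * K))
        (heegnerPt Q hA (by rw [hdisc, neg_lt_zero]; positivity)) := by
  have ha' : (0 : ℝ) < a := by exact_mod_cast ha
  have hA' : (0 : ℝ) < Q.a := by exact_mod_cast hA
  have hs : Real.sqrt (-(Q.disc : ℝ)) = 2 * Real.sqrt ((a * h : ℕ) : ℝ) := by
    rw [hdisc]; push_cast
    rw [show -(-(4 * (a : ℝ) * h)) = 2 ^ 2 * (a * h) by ring, Real.sqrt_mul (by norm_num),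
      Real.sqrt_sq (by norm_num)]
  have hsqrt0 : 0 < Real.sqrt ((a * h : ℕ) : ℝ) := Real.sqrt_pos.mpr (by positivity)
  unfold formWeight skewTestFun
  rw [heegnerPt_im', heegnerPt_re', hs]
  congr 1
  · congr 1
    field_simp
  · congr 1
    field_simp

end bridgeHeegner

/-! ## Part 3: classes, representatives, transversals -/

section bridgeClasses

open RootForms

/-- A negative integer is not a square. [folklore] -/
theorem not_isSquare_of_neg {Δ : ℤ} (hΔ : Δ < 0) : ¬ IsSquare Δ := by
  rintro ⟨r, hr⟩
  nlinarith [mul_self_nonneg r]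

/-- **The canonical reduced representative** of the class of a positive definite form: a
Lagrange-reduced form (`|B| ≤ A ≤ C`) with `A > 0` in the `SL₂(ℤ)`-class of `Q` — a choice,
constant on classes (`lrep_smul`); GM's set of representatives `L_h ↔ Λ_h` (Heegner points in
the standard fundamental domain). [cite: GrimmeltMerikoski2025, §3.1 (Λ_h, L_h)] -/
def lrep (Q : BinQF) : BinQF :=
  Classical.epsilon (fun R : BinQF => IsLagrangeReduced R ∧ 0 < R.a ∧ ∃ ξ : SL(2, ℤ), Q = smul R ξ)

/-- Specification of `lrep` for a positive definite form of negative discriminant. [folklore] -/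
theorem lrep_spec {Q : BinQF} (hA : 0 < Q.a) (hΔ : Q.disc < 0) :
    IsLagrangeReduced (lrep Q) ∧ 0 < (lrep Q).a ∧ ∃ ξ : SL(2, ℤ), Q = smul (lrep Q) ξ := by
  obtain ⟨ξ, hred⟩ := exists_smul_isLagrangeReduced (not_isSquare_of_neg hΔ)
  have hpos : 0 < (smul Q ξ).a := smul_a_pos_of_definite hA hΔ ξ
  exact Classical.epsilon_spec (p := fun R : BinQF => IsLagrangeReduced R ∧ 0 < R.a ∧
    ∃ ξ : SL(2, ℤ), Q = smul R ξ) ⟨smul Q ξ, hred, hpos, ξ⁻¹, (smul_mul_inv Q ξ).symm⟩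

/-- `lrep` is a class function. [folklore] -/
theorem lrep_smul (Q : BinQF) (γ : SL(2, ℤ)) : lrep (smul Q γ) = lrep Q := by
  unfold lrep
  have hP : (fun R : BinQF => IsLagrangeReduced R ∧ 0 < R.a ∧ ∃ ξ : SL(2, ℤ), smul Q γ = smul R ξ) =
      (fun R : BinQF => IsLagrangeReduced R ∧ 0 < R.a ∧ ∃ ξ : SL(2, ℤ), Q = smul R ξ) := by
    funext R
    apply propext
    refine and_congr_right fun _ => and_congr_right fun _ => ⟨?_, ?_⟩
    · rintro ⟨ξ, h⟩
      exact ⟨ξ * γ⁻¹, by rw [smul_mul, ← h, smul_mul_inv]⟩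
    · rintro ⟨ξ, h⟩
      exact ⟨ξ * γ, by rw [smul_mul, ← h]⟩
  rw [hP]

/-- `disc (lrep Q) = disc Q`. [folklore] -/
theorem lrep_disc {Q : BinQF} (hA : 0 < Q.a) (hΔ : Q.disc < 0) : (lrep Q).disc = Q.disc := by
  obtain ⟨-, -, ξ, h⟩ := lrep_spec hA hΔ
  conv_rhs => rw [h, smul_disc]

/-- The stabiliser of a positive definite form as a finite set. [folklore] -/
def stabFinset (R : BinQF) (hA : 0 < R.a) (hΔ : R.disc < 0) : Finset SL(2, ℤ) :=
  (@Set.toFinite _ (stab R : Set SL(2, ℤ)) (finite_stab_of_definite hA hΔ)).toFinset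

/-- Membership in `stabFinset`. [folklore] -/
theorem mem_stabFinset {R : BinQF} (hA : 0 < R.a) (hΔ : R.disc < 0) {s : SL(2, ℤ)} :
    s ∈ stabFinset R hA hΔ ↔ smul R s = R := by
  unfold stabFinset
  rw [Set.Finite.mem_toFinset]
  exact mem_stab_iff

/-- `1 ∈ stabFinset`, so it is non-empty and `|stab R| ≥ 1`. [folklore] -/
theorem one_mem_stabFinset {R : BinQF} (hA : 0 < R.a) (hΔ : R.disc < 0) : (1 : SL(2, ℤ)) ∈ stabFinset R hA hΔ :=
  (mem_stabFinset hA hΔ).mpr (smul_one R)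

/-- **A left transversal of `Γ₀(q)` in `SL₂(ℤ)`**: every `ξ` is `τγ` with `γ ∈ Γ₀(q)` for a
unique `τ` in the set (the inverses of a right transversal, `DFI1995.exists_rightTransversal`);
GM's `T_q = Γ₀(q)∖SL₂(ℤ)` read on the right. [cite: GrimmeltMerikoski2025, Lemma 3.1 (T_q)] -/
def leftTrans (q : ℕ) : Finset SL(2, ℤ) :=
  if hq : q = 0 then ∅ else (Classical.choose (@DFI1995.exists_rightTransversal q ⟨hq⟩)).image (·⁻¹)

/-- The transversal property: `∃! τ ∈ leftTrans q, τ⁻¹ ξ ∈ Γ₀(q)`. [folklore] -/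
theorem leftTrans_existsUnique (q : ℕ) [NeZero q] (ξ : SL(2, ℤ)) :
    ∃! τ : SL(2, ℤ), τ ∈ leftTrans q ∧ τ⁻¹ * ξ ∈ CongruenceSubgroup.Gamma0 q := by
  have hq : q ≠ 0 := NeZero.ne q
  have hT := Classical.choose_spec (@DFI1995.exists_rightTransversal q ⟨hq⟩)
  unfold leftTrans
  rw [dif_neg hq]
  obtain ⟨t, ⟨htT, ht⟩, huniq⟩ := hT ξ⁻¹
  refine ⟨t⁻¹, ⟨mem_image.mpr ⟨t, htT, rfl⟩, ?_⟩, ?_⟩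
  · rw [inv_inv]
    have : ξ⁻¹ * t⁻¹ = (t * ξ)⁻¹ := by group
    rw [this] at ht
    simpa using (CongruenceSubgroup.Gamma0 q).inv_mem ht
  · rintro τ ⟨hτ, hτξ⟩
    obtain ⟨t', ht'T, rfl⟩ := mem_image.mp hτ
    simp only [inv_inv] at hτξ ⊢
    congr 1
    refine huniq t' ⟨ht'T, ?_⟩
    have : ξ⁻¹ * t'⁻¹ = (t' * ξ)⁻¹ := by group
    rw [this]
    exact (CongruenceSubgroup.Gamma0 q).inv_mem hτξ

end bridgeClasses

section bridgeOrbits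

open RootForms

variable {R : BinQF}

/-- For `ξ` with `R·ξ = Q`: the set of all `ξ'` with `R·ξ' = Q` is the coset `stab R · ξ`.
The finite set `Ξ` of all `ξ` with `R·ξ ∈ L` for a finite set `L` of forms in the class of `R`.
[folklore] -/
def classLifts (R : BinQF) (hA : 0 < R.a) (hΔ : R.disc < 0) (L : Finset BinQF)
    (ξ₀ : BinQF → SL(2, ℤ)) : Finset SL(2, ℤ) :=
  L.biUnion fun Q => (stabFinset R hA hΔ).image (· * ξ₀ Q)

/-- Membership in `classLifts`: if every `Q ∈ L` is `R·ξ₀(Q)`, then `ξ ∈ Ξ ↔ R·ξ ∈ L`. [folklore] -/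
theorem mem_classLifts_iff (hA : 0 < R.a) (hΔ : R.disc < 0) {L : Finset BinQF} {ξ₀ : BinQF → SL(2, ℤ)}
    (hξ₀ : ∀ Q ∈ L, smul R (ξ₀ Q) = Q) {ξ : SL(2, ℤ)} :
    ξ ∈ classLifts R hA hΔ L ξ₀ ↔ smul R ξ ∈ L := by
  unfold classLifts
  rw [mem_biUnion]
  constructor
  · rintro ⟨Q, hQ, hξ⟩
    obtain ⟨s, hs, rfl⟩ := mem_image.mp hξ
    rw [smul_mul, (mem_stabFinset hA hΔ).mp hs, hξ₀ Q hQ]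
    exact hQ
  · intro hξ
    refine ⟨smul R ξ, hξ, mem_image.mpr ⟨ξ * (ξ₀ (smul R ξ))⁻¹, ?_, by group⟩⟩
    rw [mem_stabFinset hA hΔ]
    have h1 : smul R (ξ₀ (smul R ξ)) = smul R ξ := hξ₀ _ hξ
    -- `ξ₀ · ξ⁻¹ ∈ stab`, hence its inverse
    have h2 : ξ₀ (smul R ξ) * ξ⁻¹ ∈ stab R := smul_eq_smul_iff.mp h1.symm
    have h3 := (stab R).inv_mem h2
    rw [mem_stab_iff] at h3
    convert h3 using 2
    group

/-- **Summing over all lifts**: `∑_{ξ ∈ Ξ} f(R·ξ) = |stab R| · ∑_{Q ∈ L} f(Q)`. [cite: GrimmeltMerikoski2025, Lemma 3.1 (the factor Γ_{σi}∖Γ)] -/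
theorem sum_classLifts (hA : 0 < R.a) (hΔ : R.disc < 0) {L : Finset BinQF} {ξ₀ : BinQF → SL(2, ℤ)}
    (hξ₀ : ∀ Q ∈ L, smul R (ξ₀ Q) = Q) (f : BinQF → ℂ) :
    ∑ ξ ∈ classLifts R hA hΔ L ξ₀, f (smul R ξ) = (#(stabFinset R hA hΔ) : ℂ) * ∑ Q ∈ L, f Q := by
  unfold classLifts
  rw [sum_biUnion]
  · rw [mul_sum]
    refine sum_congr rfl fun Q hQ => ?_
    rw [sum_image fun s _ s' _ h => mul_right_cancel h]
    have : ∀ s ∈ stabFinset R hA hΔ, f (smul R (s * ξ₀ Q)) = f Q := by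
      intro s hs
      rw [smul_mul, (mem_stabFinset hA hΔ).mp hs, hξ₀ Q hQ]
    rw [sum_congr rfl this, sum_const, nsmul_eq_mul]
  · -- disjointness: the lifts of different `Q` act to different forms
    intro Q hQ Q' hQ' hne
    rw [Function.onFun, disjoint_left]
    intro ξ hξ hξ'
    obtain ⟨s, hs, rfl⟩ := mem_image.mp hξ
    obtain ⟨s', hs', he⟩ := mem_image.mp hξ'
    apply hne
    have e1 : smul R (s * ξ₀ Q) = Q := by rw [smul_mul, (mem_stabFinset hA hΔ).mp hs, hξ₀ Q hQ]
    have e2 : smul R (s' * ξ₀ Q') = Q' := by rw [smul_mul, (mem_stabFinset hA hΔ).mp hs', hξ₀ Q' hQ']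
    rw [← e1, ← e2, he]

/-- **Decomposition along the transversal**: for any finite `Ξ ⊆ SL₂(ℤ)`,
`∑_{ξ ∈ Ξ} g(ξ) = ∑_{τ ∈ T} ∑_{ξ ∈ Ξ, τ⁻¹ξ ∈ Γ₀(q)} g(ξ)` (each `ξ` has exactly one `τ`).
[cite: GrimmeltMerikoski2025, Lemma 3.1 (⊔ over τ ∈ T_q)] -/
theorem sum_eq_sum_leftTrans (q : ℕ) [NeZero q] [DecidablePred (· ∈ CongruenceSubgroup.Gamma0 q)]
    (Ξ : Finset SL(2, ℤ)) (g : SL(2, ℤ) → ℂ) :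
    ∑ ξ ∈ Ξ, g ξ = ∑ τ ∈ leftTrans q, ∑ ξ ∈ Ξ.filter (fun ξ => τ⁻¹ * ξ ∈ CongruenceSubgroup.Gamma0 q), g ξ := by
  classical
  simp_rw [sum_filter]
  rw [sum_comm]
  refine sum_congr rfl fun ξ _ => ?_
  rw [← sum_filter]
  obtain ⟨τ, ⟨hτ, hτξ⟩, huniq⟩ := leftTrans_existsUnique q ξ
  have : (leftTrans q).filter (fun τ' => τ'⁻¹ * ξ ∈ CongruenceSubgroup.Gamma0 q) = {τ} := by
    ext τ'
    rw [mem_filter, mem_singleton]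
    constructor
    · rintro ⟨h1, h2⟩; exact huniq τ' ⟨h1, h2⟩
    · rintro rfl; exact ⟨hτ, hτξ⟩
  rw [this, sum_singleton]

/-- **A fibre of the transversal is an orbit sum.**  Let `w = τ⁻¹·z_R`.  If `Φ = φ ∘ heegnerPt`
on the class of `R` and every `γ ∈ Γ₀(q)` with `Φ(R·(τγ)) ≠ 0` has `τγ ∈ Ξ`, and conversely
`Ξ ∋ ξ ↦ R·ξ` is compatible (`ξ ∈ Ξ ↔ …` not needed), then
`∑_{ξ ∈ Ξ, τ⁻¹ξ ∈ Γ₀(q)} Φ(R·ξ) = orbitSum Γ₀(q) φ w`.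
[cite: GrimmeltMerikoski2025, Lemma 3.1 and §5 ("by Lemma 3.1 … = ⟨I|𝒦_{ad}F|α⟩")] -/
theorem sum_fibre_eq_orbitSum (hA : 0 < R.a) (hΔ : R.disc < 0) {q : ℕ} [NeZero q]
    [DecidablePred (· ∈ CongruenceSubgroup.Gamma0 q)]
    (Ξ : Finset SL(2, ℤ)) (τ : SL(2, ℤ)) (Φ : BinQF → ℂ) (φ : ℍ → ℂ)
    (hΦφ : ∀ ξ : SL(2, ℤ), Φ (smul R ξ) = φ (ξ⁻¹ • heegnerPt R hA hΔ))
    (hsupp : ∀ γ ∈ CongruenceSubgroup.Gamma0 q, Φ (smul R (τ * γ)) ≠ 0 → τ * γ ∈ Ξ) :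
    ∑ ξ ∈ Ξ.filter (fun ξ => τ⁻¹ * ξ ∈ CongruenceSubgroup.Gamma0 q), Φ (smul R ξ) =
      orbitSum (DFI1995.Gamma0GL q) φ (τ⁻¹ • heegnerPt R hA hΔ) := by
  classical
  set w : ℍ := τ⁻¹ • heegnerPt R hA hΔ with hw
  set F := Ξ.filter (fun ξ => τ⁻¹ * ξ ∈ CongruenceSubgroup.Gamma0 q) with hF
  set ι : SL(2, ℤ) → GL (Fin 2) ℝ := fun ξ => Matrix.SpecialLinearGroup.mapGL ℝ (ξ⁻¹ * τ) with hι
  have hιinj : Function.Injective ι := by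
    intro ξ ξ' h
    have := DFI1995.mapGL_injective h
    have := mul_right_cancel this
    exact inv_injective this
  set S : Finset (GL (Fin 2) ℝ) := F.image ι with hS
  -- the action of `ι ξ` on `w`
  have hact : ∀ ξ : SL(2, ℤ), ι ξ • w = ξ⁻¹ • heegnerPt R hA hΔ := by
    intro ξ
    rw [hw, hι]
    show (ξ⁻¹ * τ) • τ⁻¹ • heegnerPt R hA hΔ = _
    rw [smul_smul, mul_assoc, mul_inv_cancel, mul_one]
  have hSΓ : (↑S : Set (GL (Fin 2) ℝ)) ⊆ DFI1995.Gamma0GL q := by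
    intro g hg
    rw [mem_coe, hS, mem_image] at hg
    obtain ⟨ξ, hξ, rfl⟩ := hg
    rw [hF, mem_filter] at hξ
    rw [hι, SetLike.mem_coe, DFI1995.mapGL_mem_Gamma0GL_iff]
    have := (CongruenceSubgroup.Gamma0 q).inv_mem hξ.2
    simpa using this
  have hsupp' : ∀ g ∈ DFI1995.Gamma0GL q, φ (g • w) ≠ 0 → g ∈ (↑S : Set (GL (Fin 2) ℝ)) := by
    intro g hg hne
    rw [DFI1995.mem_Gamma0GL_iff] at hg
    obtain ⟨γ, hγ, rfl⟩ := hg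
    -- `mapGL γ • w = (τγ⁻¹)⁻¹ • z_R`
    have e : Matrix.SpecialLinearGroup.mapGL ℝ γ • w = (τ * γ⁻¹)⁻¹ • heegnerPt R hA hΔ := by
      rw [hw]
      show γ • τ⁻¹ • heegnerPt R hA hΔ = _
      rw [smul_smul, mul_inv_rev, inv_inv]
    rw [e, ← hΦφ] at hne
    have hmem : τ * γ⁻¹ ∈ Ξ := hsupp γ⁻¹ ((CongruenceSubgroup.Gamma0 q).inv_mem hγ) hne
    rw [mem_coe, hS, mem_image]
    refine ⟨τ * γ⁻¹, ?_, ?_⟩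
    · rw [hF, mem_filter]
      refine ⟨hmem, ?_⟩
      simpa using (CongruenceSubgroup.Gamma0 q).inv_mem hγ
    · rw [hι]
      group
  rw [orbitSum_eq_sum S.finite_toSet hSΓ hsupp', Finset.finite_toSet_toFinset, hS,
    sum_image fun ξ _ ξ' _ h => hιinj h]
  refine sum_congr rfl fun ξ _ => ?_
  rw [hΦφ, hact]

end bridgeOrbits

/-! ## Part 3 (end): the smoothed count as a weighted sum of orbit sums over Heegner data -/

section bridgeMain

open RootForms

/-- The form `[A, B, (B² + 4h)/(4A)]` of a pair. [folklore] -/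
def pairForm (h : ℕ) (t : ℤ × ℤ) : BinQF := ⟨t.1, t.2, (t.2 ^ 2 + 4 * h) / (4 * t.1)⟩

/-- **The canonical class representatives** of the positive definite forms of discriminant
`−4ah`: `lrep` of the reduced forms (so that `lrep R = R` on this set and `lrep Q` lies in it for
every positive definite `Q` of that discriminant) — GM's `L_{ah}`. Depends on `(a, h)` only.
[cite: GrimmeltMerikoski2025, §3.1 (L_h) and Lemma 3.1] -/
def repsCan (a h : ℕ) : Finset BinQF := ((heegnerReps (a * h)).image (pairForm (a * h))).image lrep

/-- **The Heegner data of level `q = ad`**: pairs `(R, τ)`, `R` a canonical representative,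
`τ` in the left transversal of `Γ₀(ad)`, with `R·τ` of level `ad` and middle coefficient
`≡ 0 (mod 2a)` — GM's `(σ, τ)` with `σ ∈ L_{ah}`, `τ ∈ T_q`, `𝔠(τσi) ≡ 0 (ad)`, `𝔟(τσi) ≡ 0 (a)`.
[cite: GrimmeltMerikoski2025, Lemma 3.1 and (5.2) (α_{d,a,h})] -/
def heegPairs (a h d : ℕ) : Finset (BinQF × SL(2, ℤ)) :=
  (repsCan a h ×ˢ leftTrans (a * d)).filter
    (fun p => ((a * d : ℕ) : ℤ) ∣ (smul p.1 p.2).a ∧ 2 * (a : ℤ) ∣ (smul p.1 p.2).b)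

/-- The point `τ⁻¹ · z_R` of a Heegner datum (junk `i` if `R` is not positive definite). [cite: GrimmeltMerikoski2025, Lemma 3.1 (the points τσ i)] -/
def pairPt (p : BinQF × SL(2, ℤ)) : ℍ :=
  if hR : 0 < p.1.a ∧ p.1.disc < 0 then p.2⁻¹ • heegnerPt p.1 hR.1 hR.2 else UpperHalfPlane.I

/-- The weight `|stab R|⁻¹` of a Heegner datum (junk `0`). [cite: GrimmeltMerikoski2025, (5.2) (the factor 1/|Γ_{σi}|)] -/
def pairWt (p : BinQF × SL(2, ℤ)) : ℝ :=
  if hR : 0 < p.1.a ∧ p.1.disc < 0 then ((#(stabFinset p.1 hR.1 hR.2) : ℝ))⁻¹ else 0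

/-- `pairWt ≥ 0`. [folklore] -/
theorem pairWt_nonneg (p : BinQF × SL(2, ℤ)) : 0 ≤ pairWt p := by
  unfold pairWt; split_ifs
  · positivity
  · exact le_rfl

/-- Members of `repsCan a h` are positive definite of discriminant `−4ah`, and fixed by `lrep`.
[folklore] -/
theorem repsCan_spec {a h : ℕ} (ha : 0 < a) (hh : 0 < h) {R : BinQF} (hR : R ∈ repsCan a h) :
    0 < R.a ∧ R.disc = -(4 * (a : ℤ) * h) ∧ lrep R = R := by
  unfold repsCan at hR
  rw [mem_image] at hR
  obtain ⟨R₀, hR₀, rfl⟩ := hR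
  rw [mem_image] at hR₀
  obtain ⟨t, ht, rfl⟩ := hR₀
  obtain ⟨ht1, ht4, -, -, -⟩ := mem_heegnerReps ht
  have hA0 : 0 < (pairForm (a * h) t).a := by show 0 < t.1; omega
  have hdisc0 : (pairForm (a * h) t).disc = -(4 * (a : ℤ) * h) := by
    have := Int.mul_ediv_cancel' ht4
    simp only [pairForm, BinQF.disc]
    push_cast at this ⊢
    linarith
  have hΔ0 : (pairForm (a * h) t).disc < 0 := by rw [hdisc0, neg_lt_zero]; positivity
  obtain ⟨-, hpos, ξ, hξ⟩ := lrep_spec hA0 hΔ0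
  refine ⟨hpos, by rw [lrep_disc hA0 hΔ0, hdisc0], ?_⟩
  conv_lhs => rw [← lrep_smul (lrep (pairForm (a * h) t)) ξ, ← hξ]

/-- For a positive definite `Q` of discriminant `−4ah`: `lrep Q ∈ repsCan a h`. [folklore] -/
theorem lrep_mem_repsCan {a h : ℕ} (ha : 0 < a) (hh : 0 < h) {Q : BinQF} (hA : 0 < Q.a)
    (hdisc : Q.disc = -(4 * (a : ℤ) * h)) : lrep Q ∈ repsCan a h := by
  have hΔ : Q.disc < 0 := by rw [hdisc, neg_lt_zero]; positivity
  obtain ⟨hred, hpos, ξ, hξ⟩ := lrep_spec hA hΔ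
  have hdiscR : (lrep Q).disc = -(4 * (a : ℤ) * h) := by rw [lrep_disc hA hΔ, hdisc]
  have key : lrep (lrep Q) = lrep Q := by
    conv_lhs => rw [← lrep_smul (lrep Q) ξ, ← hξ]
  generalize lrep Q = R at hred hpos hdiscR key ⊢
  have hM : (0 : ℤ) < (a : ℤ) * h := by positivity
  have hCR : 4 * R.a * R.c = R.b ^ 2 + 4 * ((a : ℤ) * h) := by
    have := hdiscR; rw [BinQF.disc] at this; linarith
  obtain ⟨hb, hc⟩ := hred
  rw [abs_of_pos hpos] at hb hc
  have hCpos : 0 < R.c := by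
    by_contra hle
    have hle' : R.c ≤ 0 := not_lt.mp hle
    have : R.a * R.c ≤ 0 := mul_nonpos_of_nonneg_of_nonpos hpos.le hle'
    nlinarith [sq_nonneg R.b]
  rw [abs_of_pos hCpos] at hc
  have hBB : R.b ^ 2 ≤ R.a ^ 2 := by
    have := abs_le.mp hb
    nlinarith
  have hAC : R.a * R.a ≤ R.a * R.c := mul_le_mul_of_nonneg_left hc hpos.le
  have h3 : 3 * R.a ^ 2 ≤ 4 * ((a : ℤ) * h) := by nlinarith
  have hA1 : R.a ≤ R.a ^ 2 := by nlinarith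
  have hA2 : R.a ≤ 2 * ((a : ℤ) * h) := by nlinarith
  have hmem : (R.a, R.b) ∈ heegnerReps (a * h) := by
    unfold heegnerReps
    rw [mem_filter, mem_product, mem_Icc, mem_Icc]
    simp only []
    have := abs_le.mp hb
    refine ⟨⟨⟨by omega, ?_⟩, ?_, ?_⟩, ⟨R.c, by push_cast; linarith⟩, hb, by push_cast; linarith⟩
    · push_cast; linarith
    · push_cast; linarith
    · push_cast; linarith
  have hRform : pairForm (a * h) (R.a, R.b) = R := by
    cases hR : R with
    | mk A B C =>
      rw [hR] at hCR hpos
      simp only [pairForm, BinQF.mk.injEq, true_and]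
      simp only at hCR hpos
      push_cast
      rw [← hCR, show 4 * A * C = (4 * A) * C by ring, Int.mul_ediv_cancel_left _ (by positivity)]
  unfold repsCan
  rw [mem_image]
  exact ⟨R, mem_image.mpr ⟨(R.a, R.b), hmem, hRform⟩, key⟩

/-- **Lemma 3.1 of [GrimmeltMerikoski2025] as an identity of sums.**  For `a, h, d ≥ 1`,
`q = ad`, weights `ψ₁` supported on `[1, 2]`, `ψ₂` on `[−1, 1]`, `K, X' > 0` and a box
`N_k ≥ 2K`:
`∑_Q Φ(Q) = ∑_{(R, τ) ∈ heegPairs} |stab R|⁻¹ · orbitSum Γ₀(q) φ (τ⁻¹·z_R)`,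
`Q` over the level forms of Part 1 (`= ∑_{k ≡ 0 (d)} ψ₁(k/K) ∑_{aℓ²+h ≡ 0 (k)} ψ₂(ℓ/X')` by
`sum_rootSum_eq_sum_forms`), `Φ = formWeight`, `φ = skewTestFun ψ₁ (ψ₂(−·)) (X'/K) (√(ah)/(aK))`
— the paper's `∑_k ψ₁(k/K) ∑_ℓ ψ₂(ℓ/X_j) = ⟨I|𝒦_{ad} F_j|α_{d,a,h}⟩`.
[cite: GrimmeltMerikoski2025, Lemma 3.1 and §5 (display "By Lemma 3.1 … = ⟨I|Δ_{ad}F₁|α⟩ − ⟨I|Δ_{ad}F₂|α⟩")] -/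
theorem sum_forms_eq_sum_heegPairs {a h d : ℕ} (ha : 0 < a) (hh : 0 < h) [NeZero (a * d)]
    (ψ₁ ψ₂ : ℝ → ℂ) (hψ₁ : ∀ u, ψ₁ u ≠ 0 → 1 ≤ u ∧ u ≤ 2) (hψ₂ : ∀ u, ψ₂ u ≠ 0 → -1 ≤ u ∧ u ≤ 1)
    {K X' : ℝ} (hK : 0 < K) (hX : 0 < X') {Nk : ℕ} (hNk : ∀ k : ℕ, (k : ℝ) ≤ 2 * K → k ≤ Nk) :
    ∑ Q ∈ ((((Icc 1 Nk).filter (d ∣ ·)) ×ˢ (Icc (-(⌈X'⌉ : ℤ)) ⌈X'⌉)).filter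
          (fun p : ℕ × ℤ => (p.1 : ℤ) ∣ (a : ℤ) * p.2 ^ 2 + (h : ℤ))).image (klForm a h),
        formWeight a ψ₁ ψ₂ K X' Q =
      ∑ p ∈ heegPairs a h d, (pairWt p : ℂ) *
        orbitSum (DFI1995.Gamma0GL (a * d))
          (skewTestFun ψ₁ (fun s => ψ₂ (-s)) (X' / K) (Real.sqrt ((a * h : ℕ) : ℝ) / (a * K))) (pairPt p) := by
  classical
  set q : ℕ := a * d with hq
  set Δ : ℤ := -(4 * (a : ℤ) * h) with hΔdef
  have hΔneg : Δ < 0 := by rw [hΔdef, neg_lt_zero]; positivity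
  set LF := ((((Icc 1 Nk).filter (d ∣ ·)) ×ˢ (Icc (-(⌈X'⌉ : ℤ)) ⌈X'⌉)).filter
          (fun p : ℕ × ℤ => (p.1 : ℤ) ∣ (a : ℤ) * p.2 ^ 2 + (h : ℤ))).image (klForm a h) with hLF
  set Φ := formWeight a ψ₁ ψ₂ K X' with hΦ
  set φ := skewTestFun ψ₁ (fun s => ψ₂ (-s)) (X' / K) (Real.sqrt ((a * h : ℕ) : ℝ) / (a * K)) with hφ
  have hLFmem : ∀ Q, Q ∈ LF ↔ IsLevelForm a 0 Δ (a * d) Q ∧ 0 < Q.a ∧ Q.a ≤ (a : ℤ) * Nk ∧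
      |Q.b| ≤ 2 * (a : ℤ) * ⌈X'⌉ := fun Q => mem_image_klForm_iff ha
  -- (ii) `lrep` maps `LF` into `repsCan`
  have hmaps : ∀ Q ∈ LF, lrep Q ∈ repsCan a h := by
    intro Q hQ
    obtain ⟨hlev, hA, -, -⟩ := (hLFmem Q).mp hQ
    exact lrep_mem_repsCan ha hh hA hlev.disc_eq
  rw [← sum_fiberwise_of_maps_to hmaps]
  -- the product/filter structure of `heegPairs`
  have hrhs : ∑ p ∈ heegPairs a h d, (pairWt p : ℂ) * orbitSum (DFI1995.Gamma0GL q) φ (pairPt p) =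
      ∑ R ∈ repsCan a h, ∑ τ ∈ (leftTrans q).filter
        (fun τ => (q : ℤ) ∣ (smul R τ).a ∧ 2 * (a : ℤ) ∣ (smul R τ).b),
          (pairWt (R, τ) : ℂ) * orbitSum (DFI1995.Gamma0GL q) φ (pairPt (R, τ)) := by
    unfold heegPairs
    rw [sum_filter, sum_product]
    refine sum_congr rfl fun R _ => ?_
    rw [sum_filter]
  rw [hrhs]
  refine sum_congr rfl fun R hR => ?_
  obtain ⟨hRA, hRdisc, hRfix⟩ := repsCan_spec ha hh hR
  have hRΔ : R.disc < 0 := by rw [hRdisc]; exact hΔneg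
  -- (v) lifts
  set L := LF.filter (fun Q => lrep Q = R) with hL
  have hLspec : ∀ Q ∈ L, ∃ ξ : SL(2, ℤ), Q = smul R ξ := by
    intro Q hQ
    rw [hL, mem_filter] at hQ
    obtain ⟨hlev, hA, -, -⟩ := (hLFmem Q).mp hQ.1
    have hQΔ : Q.disc < 0 := by rw [hlev.disc_eq]; exact hΔneg
    obtain ⟨-, -, ξ, hξ⟩ := lrep_spec hA hQΔ
    rw [hQ.2] at hξ
    exact ⟨ξ, hξ⟩
  choose! ξ₀ hξ₀ using hLspec
  have hξ₀' : ∀ Q ∈ L, smul R (ξ₀ Q) = Q := fun Q hQ => (hξ₀ Q hQ).symm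
  set Ξ := classLifts R hRA hRΔ L ξ₀ with hΞ
  have hcard : (#(stabFinset R hRA hRΔ) : ℂ) ≠ 0 := by
    have : 0 < #(stabFinset R hRA hRΔ) := card_pos.mpr ⟨1, one_mem_stabFinset hRA hRΔ⟩
    exact_mod_cast this.ne'
  have hstep1 : ∑ Q ∈ L, Φ Q = (#(stabFinset R hRA hRΔ) : ℂ)⁻¹ * ∑ ξ ∈ Ξ, Φ (smul R ξ) := by
    rw [sum_classLifts hRA hRΔ hξ₀' Φ, ← mul_assoc, inv_mul_cancel₀ hcard, one_mul]
  -- (vi) decompose along the transversal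
  rw [hstep1, sum_eq_sum_leftTrans q Ξ (fun ξ => Φ (smul R ξ)), mul_sum]
  -- (vii) fibres
  rw [sum_filter]
  refine sum_congr rfl fun τ _ => ?_
  -- the weight and the point of `(R, τ)`
  have hwt : (pairWt (R, τ) : ℂ) = (#(stabFinset R hRA hRΔ) : ℂ)⁻¹ := by
    unfold pairWt; rw [dif_pos ⟨hRA, hRΔ⟩]; push_cast; rfl
  have hpt : pairPt (R, τ) = τ⁻¹ • heegnerPt R hRA hRΔ := by
    unfold pairPt; rw [dif_pos ⟨hRA, hRΔ⟩]
  -- `Φ(R·ξ) = φ(ξ⁻¹ z_R)`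
  have hΦφ : ∀ ξ : SL(2, ℤ), Φ (smul R ξ) = φ (ξ⁻¹ • heegnerPt R hRA hRΔ) := by
    intro ξ
    rw [← heegnerPt_smul hRA hRΔ ξ]
    exact formWeight_eq_skewTestFun ha hh ψ₁ ψ₂ hK hX (smul_a_pos_of_definite hRA hRΔ ξ)
      (by rw [smul_disc, hRdisc])
  by_cases hlev : (q : ℤ) ∣ (smul R τ).a ∧ 2 * (a : ℤ) ∣ (smul R τ).b
  · rw [if_pos hlev, hwt, hpt]
    congr 1
    refine sum_fibre_eq_orbitSum hRA hRΔ Ξ τ Φ φ hΦφ fun γ hγ hne => ?_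
    -- (3b.4) support ⊆ lifts
    rw [hΞ, mem_classLifts_iff hRA hRΔ hξ₀', hL, mem_filter]
    have hlevτ : IsLevelForm a 0 Δ q (smul R τ) :=
      ⟨by rw [smul_disc, hRdisc], hlev.1, by rw [sub_zero]; exact hlev.2⟩
    have haq : (a : ℤ) ∣ (q : ℤ) := by rw [hq]; push_cast; exact dvd_mul_right _ _
    have hlevτγ : IsLevelForm a 0 Δ q (smul R (τ * γ)) := by rw [smul_mul]; exact hlevτ.smul haq hγ
    have hApos : 0 < (smul R (τ * γ)).a := smul_a_pos_of_definite hRA hRΔ _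
    refine ⟨(hLFmem _).mpr ⟨hlevτγ, hApos, ?_, ?_⟩, by rw [lrep_smul, hRfix]⟩
    · -- `ψ₁(A/(aK)) ≠ 0 ⇒ A = a k' with k' ≤ 2K, so k' ≤ N_k`
      have h1 : ψ₁ (((smul R (τ * γ)).a : ℝ) / (a * K)) ≠ 0 := left_ne_zero_of_mul hne
      have h2 := (hψ₁ _ h1).2
      rw [div_le_iff₀ (by positivity)] at h2
      -- `a ∣ A'`
      obtain ⟨k', hk'⟩ : (a : ℤ) ∣ (smul R (τ * γ)).a := haq.trans hlevτγ.level_dvd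
      have hk'pos : 0 < k' := by
        have : 0 < (a : ℤ) * k' := hk' ▸ hApos
        exact pos_of_mul_pos_right this (by positivity)
      have hk'le : ((k'.toNat : ℕ) : ℝ) ≤ 2 * K := by
        have e : ((k'.toNat : ℕ) : ℤ) = k' := Int.toNat_of_nonneg hk'pos.le
        have h3 : ((a : ℝ) * k' : ℝ) ≤ 2 * (a * K) := by
          have : (((smul R (τ * γ)).a : ℤ) : ℝ) = (a : ℝ) * k' := by rw [hk']; push_cast; ring
          linarith
        have h4 : (k' : ℝ) ≤ 2 * K := by
          have ha' : (0 : ℝ) < a := by exact_mod_cast ha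
          nlinarith
        have : ((k'.toNat : ℕ) : ℝ) = ((k' : ℤ) : ℝ) := by exact_mod_cast e
        rw [this]; exact h4
      have h5 := hNk _ hk'le
      have h6 : k' ≤ Nk := by
        have e : ((k'.toNat : ℕ) : ℤ) = k' := Int.toNat_of_nonneg hk'pos.le
        rw [← e]; exact_mod_cast h5
      rw [hk']
      exact mul_le_mul_of_nonneg_left h6 (by positivity)
    · have h1 : ψ₂ (((smul R (τ * γ)).b : ℝ) / (2 * a * X')) ≠ 0 := right_ne_zero_of_mul hne
      have h2 := hψ₂ _ h1
      have hc : X' ≤ ⌈X'⌉ := Int.le_ceil X'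
      have hpos : (0 : ℝ) < 2 * a * X' := by positivity
      have h3 : |((smul R (τ * γ)).b : ℝ)| ≤ 2 * a * X' := by
        rw [abs_le]
        constructor
        · have := h2.1; rw [le_div_iff₀ hpos] at this; linarith
        · have := h2.2; rw [div_le_iff₀ hpos] at this; linarith
      have h4 : |((smul R (τ * γ)).b : ℝ)| ≤ 2 * a * (⌈X'⌉ : ℝ) := h3.trans (by nlinarith [(Nat.cast_pos.mpr ha : (0:ℝ) < a)])
      have h5 : ((|(smul R (τ * γ)).b| : ℤ) : ℝ) ≤ ((2 * (a : ℤ) * ⌈X'⌉ : ℤ) : ℝ) := by push_cast; exact h4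
      exact_mod_cast h5
  · -- non-level `τ`: the fibre is empty
    rw [if_neg hlev]
    refine mul_eq_zero_of_right _ (sum_eq_zero fun ξ hξ => ?_)
    exfalso
    rw [mem_filter, hΞ, mem_classLifts_iff hRA hRΔ hξ₀', hL, mem_filter] at hξ
    obtain ⟨⟨hLFξ, -⟩, hγ⟩ := hξ
    obtain ⟨hlevξ, -, -, -⟩ := (hLFmem _).mp hLFξ
    have haq : (a : ℤ) ∣ (q : ℤ) := by rw [hq]; push_cast; exact dvd_mul_right _ _
    have : IsLevelForm a 0 Δ q (smul R τ) := by
      have e : smul R τ = smul (smul R ξ) (τ⁻¹ * ξ)⁻¹ := by rw [← smul_mul]; congr 1; group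
      rw [e]
      exact hlevξ.smul_inv haq hγ
    exact hlev ⟨this.level_dvd, by simpa using this.mid_dvd⟩

end bridgeMain

/-! ## Part 4: the main term is linear in the `x`-scale

`∫_ℍ φ_{λ sX} dμ = λ ∫_ℍ φ_{sX} dμ` for `φ_{sX} = skewTestFun Ψ₁ Ψ₂ sX sY`: the substitution
`x ↦ λx` (not a Möbius map; it multiplies `dx dy/y²` by `λ`).  This is what makes the main terms
`m_q ∫ F_j` of the two smoothed sums (`X₁ = X`, `X₂`) cancel after the normalisation `X/X_j` of
§5 of the paper ("the main terms cancel"). -/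

section bridgeStretch

open MeasureTheory
open Literature.NumberTheory.Automorphic (integral_upperHalfPlane_eq_integral_complex)

/-- `∫ H(cx, y) dx dy = |c|⁻¹ ∫ H` on `ℝ × ℝ` (no integrability needed). [folklore] -/
theorem integral_comp_xStretch (H : ℝ × ℝ → ℂ) {c : ℝ} (hc : c ≠ 0) :
    ∫ p : ℝ × ℝ, H (c * p.1, p.2) = (|c⁻¹| : ℝ) * ∫ p, H p := by
  set e : ℝ × ℝ ≃ᵐ ℝ × ℝ :=
    MeasurableEquiv.prodCongr (MeasurableEquiv.mulLeft₀ c hc) (MeasurableEquiv.refl ℝ) with he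
  have hecoe : (e : ℝ × ℝ → ℝ × ℝ) = Prod.map (c * ·) id := rfl
  have hmap : Measure.map e (volume : Measure (ℝ × ℝ)) = ENNReal.ofReal |c⁻¹| • volume := by
    rw [hecoe, Measure.volume_eq_prod, ← Measure.map_prod_map _ _ (measurable_const_mul c)
      measurable_id, Real.map_volume_mul_left hc, Measure.map_id, Measure.prod_smul_left]
  have h1 : ∫ p : ℝ × ℝ, H (c * p.1, p.2) = ∫ p, H (e p) := by rfl
  rw [h1, ← integral_map_equiv e H, hmap, integral_smul_measure,
    ENNReal.toReal_ofReal (abs_nonneg _), Complex.real_smul]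

/-- `∫ F(c·Re z + i Im z) dA(z) = |c|⁻¹ ∫ F dA` on `ℂ`. [folklore] -/
theorem integral_comp_reStretch (F : ℂ → ℂ) {c : ℝ} (hc : c ≠ 0) :
    ∫ z : ℂ, F ⟨c * z.re, z.im⟩ = (|c⁻¹| : ℝ) * ∫ z, F z := by
  have hmp := Complex.volume_preserving_equiv_real_prod
  have h1 : ∀ G : ℂ → ℂ, ∫ z, G z = ∫ p : ℝ × ℝ, G ⟨p.1, p.2⟩ := by
    intro G
    rw [← hmp.integral_comp' (g := fun p : ℝ × ℝ => G ⟨p.1, p.2⟩)]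
    simp [Complex.measurableEquivRealProd_apply]
  rw [h1, h1 F]
  exact integral_comp_xStretch (fun p => F ⟨p.1, p.2⟩) hc

/-- **The main term is linear in `sX`**: `∫_ℍ skewTestFun Ψ₁ Ψ₂ (c·sX) sY = c ∫_ℍ skewTestFun Ψ₁ Ψ₂ sX sY`
(`c > 0`; `∫_ℍ φ = (sX/sY) Ψ̂₂(0) ∫ Ψ₁(1/y) dy/y`). [cite: GrimmeltMerikoski2025, §5 ("Note that thanks to the normalization, the main terms cancel")] -/
theorem integral_skewTestFun_xStretch (Ψ₁ Ψ₂ : ℝ → ℂ) (sX sY : ℝ) {c : ℝ} (hc : 0 < c) :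
    ∫ z : ℍ, skewTestFun Ψ₁ Ψ₂ (c * sX) sY z = (c : ℂ) * ∫ z : ℍ, skewTestFun Ψ₁ Ψ₂ sX sY z := by
  have hmeas : MeasurableSet {z : ℂ | 0 < z.im} :=
    measurableSet_lt measurable_const Complex.measurable_im
  rw [integral_upperHalfPlane_eq_integral_complex, integral_upperHalfPlane_eq_integral_complex,
    ← integral_indicator hmeas, ← integral_indicator hmeas]
  set F : ℂ → ℂ := {z : ℂ | 0 < z.im}.indicator
    (fun z => ((z.im ^ 2)⁻¹ : ℝ) • skewTestFun Ψ₁ Ψ₂ sX sY (UpperHalfPlane.ofComplex z)) with hF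
  have key : {z : ℂ | 0 < z.im}.indicator
      (fun z => ((z.im ^ 2)⁻¹ : ℝ) • skewTestFun Ψ₁ Ψ₂ (c * sX) sY (UpperHalfPlane.ofComplex z)) =
      fun z => F ⟨c⁻¹ * z.re, z.im⟩ := by
    funext z
    simp only [hF, Set.indicator, Set.mem_setOf_eq]
    by_cases hz : 0 < z.im
    · have hz' : 0 < (⟨c⁻¹ * z.re, z.im⟩ : ℂ).im := hz
      rw [if_pos hz, if_pos hz']
      congr 1
      unfold skewTestFun
      rw [UpperHalfPlane.ofComplex_apply_of_im_pos hz, UpperHalfPlane.ofComplex_apply_of_im_pos hz',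
        UpperHalfPlane.mk_im, UpperHalfPlane.mk_re, UpperHalfPlane.mk_im, UpperHalfPlane.mk_re]
      congr 2
      show z.re * sY / (z.im * (c * sX)) = c⁻¹ * z.re * sY / (z.im * sX)
      by_cases hsX : sX = 0
      · simp [hsX]
      by_cases him : z.im = 0
      · simp [him]
      field_simp
    · have hz' : ¬ 0 < (⟨c⁻¹ * z.re, z.im⟩ : ℂ).im := hz
      rw [if_neg hz, if_neg hz']
  rw [key, integral_comp_reStretch F (inv_ne_zero hc.ne'), inv_inv, abs_of_pos hc]

end bridgeStretch


/-! ## Part 5: the kernel side — `⟨I|𝒦_q k|I⟩` and `⟨α|𝒦_q k|α⟩` in arithmetic form -/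

section kernelDiag

open Literature.NumberTheory.Automorphic (pointPairInv automorphicKernel automorphicKernel_eq_sum)

/-- `((iR : ℍ) : ℂ) = R·i`. [folklore] -/
theorem coe_iPt (R : ℝ) (hR : 0 < R) : ((iPt R hR : ℍ) : ℂ) = (R : ℂ) * Complex.I := rfl

/-- `u(γ · iR, iR) = u_R(γ)` for `γ ∈ SL₂(ℤ)`. [cite: GrimmeltMerikoski2025, §2 (u_R(g) = u(g iR, iR))] -/
theorem pointPairInv_smul_iPt (γ : SL(2, ℤ)) {R : ℝ} (hR : 0 < R) :
    pointPairInv (γ • iPt R hR) (iPt R hR) = uR R ((γ 0 0, γ 0 1), (γ 1 0, γ 1 1)) := by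
  set a : ℝ := ((γ 0 0 : ℤ) : ℝ) with ha
  set b : ℝ := ((γ 0 1 : ℤ) : ℝ) with hb
  set c : ℝ := ((γ 1 0 : ℤ) : ℝ) with hc
  set d : ℝ := ((γ 1 1 : ℤ) : ℝ) with hd
  have hdet : a * d - b * c = 1 := by
    have := Matrix.SpecialLinearGroup.det_coe γ
    rw [Matrix.det_fin_two] at this
    rw [ha, hb, hc, hd]; exact_mod_cast this
  set p : ℂ := (b : ℂ) + (a * R : ℝ) * Complex.I with hp
  set q' : ℂ := (d : ℂ) + (c * R : ℝ) * Complex.I with hq'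
  have hD : 0 < d ^ 2 + (c * R) ^ 2 := by
    by_contra hle
    have hle' := not_lt.mp hle
    have hd0 : d = 0 := by nlinarith [sq_nonneg d, sq_nonneg (c * R)]
    have hc0 : c * R = 0 := by nlinarith [sq_nonneg d, sq_nonneg (c * R)]
    have : c = 0 := by
      rcases mul_eq_zero.mp hc0 with h | h
      · exact h
      · exact absurd h hR.ne'
    rw [hd0, this] at hdet; simp at hdet
  have hD1 : R ^ 2 * c ^ 2 + d ^ 2 ≠ 0 := by nlinarith
  have hD2 : c ^ 2 * R ^ 2 + d ^ 2 ≠ 0 := by nlinarith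
  have hD3 : d ^ 2 + (c * R) ^ 2 ≠ 0 := hD.ne'
  have hq'ns : Complex.normSq q' = d ^ 2 + (c * R) ^ 2 := by
    rw [hq', Complex.normSq_apply]; simp; ring
  have hq'0 : q' ≠ 0 := by
    intro h0; rw [h0, map_zero] at hq'ns; linarith
  have hZ : ((γ • iPt R hR : ℍ) : ℂ) = p / q' := by
    rw [coe_specialLinearGroup_apply, coe_iPt]
    simp only [eq_intCast, hp, hq', ha, hb, hc, hd]
    push_cast
    ring_nf
  have hZim : (γ • iPt R hR).im = R / (d ^ 2 + (c * R) ^ 2) := by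
    rw [← UpperHalfPlane.coe_im, hZ, Complex.div_im, hq'ns, div_sub_div_same]
    congr 1
    simp only [hp, hq', Complex.add_re, Complex.ofReal_re, Complex.mul_re, Complex.I_re,
      Complex.ofReal_im, Complex.I_im, Complex.add_im, Complex.mul_im]
    linear_combination R * hdet
  have hdist : dist ((γ • iPt R hR : ℍ) : ℂ) ((iPt R hR : ℍ) : ℂ) ^ 2 =
      ((b + c * R ^ 2) ^ 2 + R ^ 2 * (a - d) ^ 2) / (d ^ 2 + (c * R) ^ 2) := by
    rw [Complex.dist_eq, hZ, coe_iPt]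
    have e : p / q' - (R : ℂ) * Complex.I = (p - (R : ℂ) * Complex.I * q') / q' := by
      field_simp
    rw [e, norm_div, div_pow, Complex.sq_norm, Complex.sq_norm, hq'ns]
    congr 1
    rw [Complex.normSq_apply]
    simp only [hp, hq', Complex.sub_re, Complex.add_re, Complex.ofReal_re, Complex.mul_re,
      Complex.I_re, Complex.ofReal_im, Complex.I_im, Complex.sub_im, Complex.add_im, Complex.mul_im]
    ring
  unfold pointPairInv uR
  rw [hdist, hZim, iPt_im]
  simp only []
  rw [← ha, ← hb, ← hc, ← hd]
  have hR0 : R ≠ 0 := hR.ne'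
  rw [div_div, div_eq_div_iff (by positivity) (by norm_num), show (4 : ℝ) * (R / (d ^ 2 + (c * R) ^ 2)) * R =
    4 * R ^ 2 / (d ^ 2 + (c * R) ^ 2) by ring,
    show (d ^ 2 + (c * R) ^ 2) * (4 * R ^ 2 / (d ^ 2 + (c * R) ^ 2)) = 4 * R ^ 2 by
      rw [mul_div_assoc', mul_div_cancel_left₀ _ hD3], div_pow]
  have e1 : b ^ 2 / R ^ 2 * R ^ 2 = b ^ 2 := div_mul_cancel₀ _ (pow_ne_zero 2 hR0)
  linear_combination (-(8:ℝ) * R ^ 2) * hdet - 4 * e1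

/-- The `SL₂(ℤ)` matrix with entries `p = ((a, b), (c, d))` (junk `1` unless `ad − bc = 1`). [folklore] -/
def toSL (p : (ℤ × ℤ) × (ℤ × ℤ)) : SL(2, ℤ) :=
  if h : p.1.1 * p.2.2 - p.1.2 * p.2.1 = 1 then
    ⟨!![p.1.1, p.1.2; p.2.1, p.2.2], by rw [Matrix.det_fin_two_of]; exact h⟩ else 1

/-- Entries of `toSL p`. [folklore] -/
theorem toSL_apply {p : (ℤ × ℤ) × (ℤ × ℤ)} (h : p.1.1 * p.2.2 - p.1.2 * p.2.1 = 1) :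
    (toSL p) 0 0 = p.1.1 ∧ (toSL p) 0 1 = p.1.2 ∧ (toSL p) 1 0 = p.2.1 ∧ (toSL p) 1 1 = p.2.2 := by
  unfold toSL; rw [dif_pos h]
  exact ⟨rfl, rfl, rfl, rfl⟩

/-- The entries map `SL₂(ℤ) → (ℤ × ℤ) × (ℤ × ℤ)`. [folklore] -/
def entries (g : SL(2, ℤ)) : (ℤ × ℤ) × (ℤ × ℤ) := ((g 0 0, g 0 1), (g 1 0, g 1 1))

/-- `toSL (entries g) = g`. [folklore] -/
theorem toSL_entries (g : SL(2, ℤ)) : toSL (entries g) = g := by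
  have hdet : g 0 0 * g 1 1 - g 0 1 * g 1 0 = 1 := by
    have := Matrix.SpecialLinearGroup.det_coe g
    rw [Matrix.det_fin_two] at this; exact this
  obtain ⟨h1, h2, h3, h4⟩ := toSL_apply (p := entries g) hdet
  ext i j
  fin_cases i <;> fin_cases j
  · exact h1
  · exact h2
  · exact h3
  · exact h4

/-- `entries (toSL p) = p` on `ad − bc = 1`. [folklore] -/
theorem entries_toSL {p : (ℤ × ℤ) × (ℤ × ℤ)} (h : p.1.1 * p.2.2 - p.1.2 * p.2.1 = 1) :
    entries (toSL p) = p := by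
  obtain ⟨h1, h2, h3, h4⟩ := toSL_apply h
  unfold entries; rw [h1, h2, h3, h4]

/-- Entry bounds on `u_R ≤ Z + 1`: `|a|, |b|, |c|, |d| ≤ √(4Z+6)·(1 + R + R⁻¹)`. [folklore] -/
theorem abs_le_of_uR_le {R Z : ℝ} (hR : 0 < R) (hZ : 0 ≤ Z) {p : (ℤ × ℤ) × (ℤ × ℤ)} (hu : uR R p ≤ Z + 1) :
    |(p.1.1 : ℝ)| ≤ Real.sqrt (4 * Z + 6) * (1 + R + R⁻¹) ∧
    |(p.1.2 : ℝ)| ≤ Real.sqrt (4 * Z + 6) * (1 + R + R⁻¹) ∧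
    |(p.2.1 : ℝ)| ≤ Real.sqrt (4 * Z + 6) * (1 + R + R⁻¹) ∧
    |(p.2.2 : ℝ)| ≤ Real.sqrt (4 * Z + 6) * (1 + R + R⁻¹) := by
  unfold uR at hu
  set S := Real.sqrt (4 * Z + 6) with hS
  have hS0 : 0 ≤ S := Real.sqrt_nonneg _
  have hS2 : S ^ 2 = 4 * Z + 6 := Real.sq_sqrt (by linarith)
  have hsum : (p.1.1 : ℝ) ^ 2 + ((p.1.2 : ℝ) / R) ^ 2 + ((p.2.1 : ℝ) * R) ^ 2 + (p.2.2 : ℝ) ^ 2 ≤ S ^ 2 := by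
    rw [hS2]; linarith
  have h1 : 1 ≤ 1 + R + R⁻¹ := by have := inv_pos.mpr hR; linarith
  have hRle : R ≤ 1 + R + R⁻¹ := by have := inv_pos.mpr hR; linarith
  have hRinv : R⁻¹ ≤ 1 + R + R⁻¹ := by linarith
  have sq_le : ∀ x : ℝ, x ^ 2 ≤ S ^ 2 → |x| ≤ S := fun x hx => abs_le_of_sq_le_sq' hx hS0 |>.elim
    (fun h1 h2 => abs_le.mpr ⟨h1, h2⟩)
  have ha : |(p.1.1 : ℝ)| ≤ S := sq_le _ (by nlinarith [sq_nonneg ((p.1.2 : ℝ) / R), sq_nonneg ((p.2.1 : ℝ) * R), sq_nonneg (p.2.2 : ℝ)])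
  have hd : |(p.2.2 : ℝ)| ≤ S := sq_le _ (by nlinarith [sq_nonneg ((p.1.2 : ℝ) / R), sq_nonneg ((p.2.1 : ℝ) * R), sq_nonneg (p.1.1 : ℝ)])
  have hb : |(p.1.2 : ℝ) / R| ≤ S := sq_le _ (by nlinarith [sq_nonneg (p.1.1 : ℝ), sq_nonneg ((p.2.1 : ℝ) * R), sq_nonneg (p.2.2 : ℝ)])
  have hc : |(p.2.1 : ℝ) * R| ≤ S := sq_le _ (by nlinarith [sq_nonneg (p.1.1 : ℝ), sq_nonneg ((p.1.2 : ℝ) / R), sq_nonneg (p.2.2 : ℝ)])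
  rw [abs_div, abs_of_pos hR, div_le_iff₀ hR] at hb
  rw [abs_mul, abs_of_pos hR, ← le_div_iff₀ hR] at hc
  refine ⟨ha.trans (by nlinarith), hb.trans (by nlinarith), hc.trans ?_, hd.trans (by nlinarith)⟩
  rw [div_eq_mul_inv]; nlinarith

/-- **`⟨I|𝒦_q k⁺_Z|I⟩` at the skewed base point is the arithmetic diagonal sum**:
`automorphicKernel Γ₀(q) k⁺_Z (iR, iR) = kernelDiagSum q R Z N` once the box `[-N, N]⁴` contains
the support (`N ≥ √(4Z+6)(1 + R + R⁻¹)`). [cite: GrimmeltMerikoski2025, §5 (K₁ = ∑_d ⟨I|Δ_{ad} k_{Z₁²,𝐗}|I⟩)] -/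
theorem automorphicKernel_iPt_eq_kernelDiagSum {q : ℕ} {R Z : ℝ} (hR : 0 < R) (hZ : 0 ≤ Z)
    {N : ℕ} (hN : Real.sqrt (4 * Z + 6) * (1 + R + R⁻¹) ≤ N) :
    automorphicKernel (DFI1995.Gamma0GL q) (kPlus Z) (iPt R hR) (iPt R hR) = kernelDiagSum q R Z N := by
  classical
  set B := (sl2Box N).filter (fun p => (q : ℤ) ∣ p.2.1) with hB
  set ι : (ℤ × ℤ) × (ℤ × ℤ) → GL (Fin 2) ℝ := fun p => Matrix.SpecialLinearGroup.mapGL ℝ (toSL p) with hι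
  set S : Finset (GL (Fin 2) ℝ) := B.image ι with hSdef
  have hdetB : ∀ p ∈ B, p.1.1 * p.2.2 - p.1.2 * p.2.1 = 1 := fun p hp => by
    rw [hB, mem_filter] at hp; exact (mem_sl2Box.mp hp.1).2.2
  have hinj : Set.InjOn ι ↑B := by
    intro p hp p' hp' h
    have h' : toSL p = toSL p' := DFI1995.mapGL_injective h
    rw [← entries_toSL (hdetB p hp), ← entries_toSL (hdetB p' hp'), h']
  have hSΓ : (↑S : Set (GL (Fin 2) ℝ)) ⊆ DFI1995.Gamma0GL q := by
    intro γ hγ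
    rw [mem_coe, hSdef, mem_image] at hγ
    obtain ⟨p, hp, rfl⟩ := hγ
    rw [hι, SetLike.mem_coe, DFI1995.mapGL_mem_Gamma0GL_iff, CongruenceSubgroup.Gamma0_mem,
      (toSL_apply (hdetB p hp)).2.2.1]
    rw [hB, mem_filter] at hp
    exact (ZMod.intCast_zmod_eq_zero_iff_dvd _ _).mpr hp.2
  have hM : ∀ u, Z + 1 ≤ u → kPlus Z u = 0 := fun u hu => kPlus_eq_zero_of_lt (by linarith)
  have hsupp : ∀ γ ∈ DFI1995.Gamma0GL q, pointPairInv (γ • iPt R hR) (iPt R hR) < Z + 1 →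
      γ ∈ (↑S : Set (GL (Fin 2) ℝ)) := by
    intro γ hγ hu
    rw [DFI1995.mem_Gamma0GL_iff] at hγ
    obtain ⟨g, hg, rfl⟩ := hγ
    have e : Matrix.SpecialLinearGroup.mapGL ℝ g • iPt R hR = g • iPt R hR := rfl
    rw [e, pointPairInv_smul_iPt] at hu
    have hdet : g 0 0 * g 1 1 - g 0 1 * g 1 0 = 1 := by
      have := Matrix.SpecialLinearGroup.det_coe g
      rw [Matrix.det_fin_two] at this; exact this
    obtain ⟨h1, h2, h3, h4⟩ := abs_le_of_uR_le hR hZ hu.le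
    simp only [] at h1 h2 h3 h4
    rw [mem_coe, hSdef, mem_image]
    refine ⟨entries g, ?_, by rw [hι]; simp only []; rw [toSL_entries]⟩
    show ((g 0 0, g 0 1), (g 1 0, g 1 1)) ∈ B
    rw [hB, mem_filter, mem_sl2Box]
    simp only []
    have i1 := abs_le.mp (h1.trans hN)
    have i2 := abs_le.mp (h2.trans hN)
    have i3 := abs_le.mp (h3.trans hN)
    have i4 := abs_le.mp (h4.trans hN)
    refine ⟨⟨⟨⟨?_, ?_⟩, ⟨?_, ?_⟩⟩, ⟨⟨?_, ?_⟩, ⟨?_, ?_⟩⟩, hdet⟩, ?_⟩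
    · exact_mod_cast i1.1
    · exact_mod_cast i1.2
    · exact_mod_cast i2.1
    · exact_mod_cast i2.2
    · exact_mod_cast i3.1
    · exact_mod_cast i3.2
    · exact_mod_cast i4.1
    · exact_mod_cast i4.2
    · rw [CongruenceSubgroup.Gamma0_mem] at hg
      exact (ZMod.intCast_zmod_eq_zero_iff_dvd _ _).mp hg
  rw [automorphicKernel_eq_sum hM _ _ S.finite_toSet hSΓ hsupp, Finset.finite_toSet_toFinset, hSdef,
    sum_image hinj]
  unfold kernelDiagSum
  refine sum_congr rfl fun p hp => ?_
  have e : ι p • iPt R hR = toSL p • iPt R hR := rfl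
  rw [e, pointPairInv_smul_iPt]
  have := entries_toSL (hdetB p hp)
  unfold entries at this
  rw [this]

end kernelDiag

section kernelHeegner

open RootForms
open Literature.NumberTheory.Automorphic (pointPairInv pointPairInv_eq_coord)

/-- **The point-pair invariant of two Heegner points** of discriminant `−4h`:
`u(z_Q, z_R) = ((B A' − B' A)² + 4h (A' − A)²) / (16 h A A')` (`= uPair h (A, B) (A', B')`).
[cite: GrimmeltMerikoski2025, §4.1.2 (display for u(w₁, z₂))] -/
theorem pointPairInv_heegnerPt {h : ℕ} (hh : 0 < h) {Q R : BinQF} (hQA : 0 < Q.a) (hQΔ : Q.disc < 0)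
    (hRA : 0 < R.a) (hRΔ : R.disc < 0) (hQ : Q.disc = -(4 * (h : ℤ))) (hR : R.disc = -(4 * (h : ℤ))) :
    pointPairInv (heegnerPt Q hQA hQΔ) (heegnerPt R hRA hRΔ) = uPair h (Q.a, Q.b) (R.a, R.b) := by
  rw [pointPairInv_eq_coord, heegnerPt_re', heegnerPt_re', heegnerPt_im', heegnerPt_im', hQ, hR]
  unfold uPair
  simp only []
  push_cast
  rw [neg_neg]
  set s := Real.sqrt (4 * h) with hs_def
  have hs : s ^ 2 = 4 * h := Real.sq_sqrt (by positivity)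
  have hs0 : 0 < s := Real.sqrt_pos.mpr (by positivity)
  have hA : (0 : ℝ) < Q.a := by exact_mod_cast hQA
  have hA' : (0 : ℝ) < R.a := by exact_mod_cast hRA
  have hh' : (0 : ℝ) < h := by exact_mod_cast hh
  rw [div_eq_div_iff (by positivity) (by positivity)]
  field_simp
  linear_combination (-4 : ℝ) * ((R.b : ℝ) * Q.a - R.a * Q.b) ^ 2 * hs

end kernelHeegner

section kernelCount

open RootForms

/-- The resultant `Res(P, P') = (AC' − A'C)² − (AB' − A'B)(BC' − B'C)` of two binary quadratic
forms. [cite: GrimmeltMerikoski2025, §4.1.2 (the quadratic form F(w₁, z₂))] -/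
def Res (P P' : BinQF) : ℤ :=
  (P.a * P'.c - P'.a * P.c) ^ 2 - (P.a * P'.b - P'.a * P.b) * (P.b * P'.c - P'.b * P.c)

/-- `Res` of two `pairForm`s is `resPair`. [folklore] -/
theorem Res_pairForm (h : ℕ) (s t : ℤ × ℤ) : Res (pairForm h s) (pairForm h t) = resPair h s t := by
  simp only [Res, resPair, pairForm, formC]

/-- **Two forms with a common level coset have `q ∣ Res`**: if `q ∣ (P·ξ).a = P(x, y)` and
`q ∣ (P'·ξ).a = P'(x, y)` for the (coprime) first column `(x, y)` of `ξ`, then `q ∣ Res(P, P')`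
(`Res·x³` and `Res·y³` are integer combinations of `P(x,y)`, `P'(x,y)`).
[cite: GrimmeltMerikoski2025, §4.1.2 ("Then for some τ we have … Therefore, F(w₁,z₂) ≡ 0 (mod q)")] -/
theorem dvd_Res_of_dvd_smul_a {P P' : BinQF} {q : ℤ} {ξ : SL(2, ℤ)}
    (h1 : q ∣ (smul P ξ).a) (h2 : q ∣ (smul P' ξ).a) : q ∣ Res P P' := by
  rw [smul_a, BinQF.eval] at h1 h2
  set x := ξ 0 0
  set y := ξ 1 0
  have hcop : IsCoprime x y := by
    refine ⟨ξ 1 1, -(ξ 0 1), ?_⟩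
    have := Matrix.SpecialLinearGroup.det_coe ξ
    rw [Matrix.det_fin_two] at this
    linear_combination this
  set w₁ := P.b * P'.c - P.c * P'.b
  set w₂ := P.c * P'.a - P.a * P'.c
  set w₃ := P.a * P'.b - P.b * P'.a
  have hRes : Res P P' = w₂ ^ 2 - w₁ * w₃ := by simp only [Res, w₁, w₂, w₃]; ring
  have hx3 : q ∣ Res P P' * x ^ 3 := by
    have e : Res P P' * x ^ 3 = (P.a * x ^ 2 + P.b * x * y + P.c * y ^ 2) * (-w₁ * P'.b * x - P'.c * (w₁ * y + w₂ * x)) +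
        (P'.a * x ^ 2 + P'.b * x * y + P'.c * y ^ 2) * (w₁ * P.b * x + P.c * (w₁ * y + w₂ * x)) := by
      rw [hRes]; simp only [w₁, w₂, w₃]; ring
    rw [e]; exact dvd_add (dvd_mul_of_dvd_left h1 _) (dvd_mul_of_dvd_left h2 _)
  have hy3 : q ∣ Res P P' * y ^ 3 := by
    have e : Res P P' * y ^ 3 = (P.a * x ^ 2 + P.b * x * y + P.c * y ^ 2) * (P'.a * (w₂ * y + w₃ * x) + w₃ * P'.b * y) +
        (P'.a * x ^ 2 + P'.b * x * y + P'.c * y ^ 2) * (-P.a * (w₂ * y + w₃ * x) - w₃ * P.b * y) := by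
      rw [hRes]; simp only [w₁, w₂, w₃]; ring
    rw [e]; exact dvd_add (dvd_mul_of_dvd_left h1 _) (dvd_mul_of_dvd_left h2 _)
  obtain ⟨u, v, huv⟩ := (hcop.pow (m := 3) (n := 3))
  have e : Res P P' = u * (Res P P' * x ^ 3) + v * (Res P P' * y ^ 3) := by
    linear_combination -Res P P' * huv
  rw [e]; exact dvd_add (dvd_mul_of_dvd_right hx3 _) (dvd_mul_of_dvd_right hy3 _)

variable {a d : ℕ}

/-- **At most one transversal element per coset, and the level transfers**: for `g, τ' ∈ SL₂(ℤ)`,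
`∑_{τ ∈ T, R·τ of level} 𝟙[τ⁻¹ g τ' ∈ Γ₀(q)] ≤ 𝟙[q ∣ ((R·g)·τ').a]`. [cite: GrimmeltMerikoski2025, §4.1 (∑_{τ ∈ T_q} α_q(τw₁) α_q(τz₂))] -/
theorem sum_transversal_indicator_le [NeZero (a * d)] [DecidablePred (· ∈ CongruenceSubgroup.Gamma0 (a * d))]
    (R : BinQF) (g τ' : SL(2, ℤ)) :
    ∑ τ ∈ (leftTrans (a * d)).filter
        (fun τ => ((a * d : ℕ) : ℤ) ∣ (smul R τ).a ∧ 2 * (a : ℤ) ∣ (smul R τ).b),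
      (if τ⁻¹ * (g * τ') ∈ CongruenceSubgroup.Gamma0 (a * d) then (1 : ℝ) else 0) ≤
    if ((a * d : ℕ) : ℤ) ∣ (smul (smul R g) τ').a then 1 else 0 := by
  obtain ⟨τ₀, ⟨hτ₀, hτ₀g⟩, huniq⟩ := leftTrans_existsUnique (a * d) (g * τ')
  rw [sum_filter]
  have key : ∀ τ ∈ leftTrans (a * d), τ ≠ τ₀ →
      (if ((a * d : ℕ) : ℤ) ∣ (smul R τ).a ∧ 2 * (a : ℤ) ∣ (smul R τ).b then
        (if τ⁻¹ * (g * τ') ∈ CongruenceSubgroup.Gamma0 (a * d) then (1 : ℝ) else 0) else 0) = 0 := by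
    intro τ hτ hne
    have : τ⁻¹ * (g * τ') ∉ CongruenceSubgroup.Gamma0 (a * d) := fun hmem => hne (huniq τ ⟨hτ, hmem⟩)
    rw [if_neg this, ite_self]
  rw [sum_eq_single_of_mem τ₀ hτ₀ (fun τ hτ hne => key τ hτ hne), if_pos hτ₀g]
  by_cases hlev : ((a * d : ℕ) : ℤ) ∣ (smul R τ₀).a ∧ 2 * (a : ℤ) ∣ (smul R τ₀).b
  · rw [if_pos hlev]
    have : ((a * d : ℕ) : ℤ) ∣ (smul (smul R g) τ').a := by
      rw [← smul_mul, show g * τ' = τ₀ * (τ₀⁻¹ * (g * τ')) by group]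
      exact (dvd_smul_mul_a_iff R τ₀ hτ₀g).2 hlev.1
    rw [if_pos this]
  · rw [if_neg hlev]; split_ifs <;> norm_num

/-- **The common-level count is bounded by `levelWeight`**: for `t ∈ heegnerReps`, `s ∈ discPairs`,
`#{τ' ∈ T : q ∣ (R_t·τ').a ∧ q ∣ (P_s·τ').a} ≤ levelWeight q s t` — zero unless `s = t` or
`q ∣ Res(s, t)` (`dvd_Res_of_dvd_smul_a`), and at most the number of level cosets of `R_t`
(`card_levelCosets_le_sum`) otherwise. [cite: GrimmeltMerikoski2025, §4.1.1–4.1.2] -/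
theorem card_commonLevel_le_levelWeight [NeZero (a * d)] (hq : 0 < a * d) (h' : ℕ) (t : ℤ × ℤ) (s : ℕ × ℤ) :
    (#((leftTrans (a * d)).filter (fun τ' => ((a * d : ℕ) : ℤ) ∣ (smul (pairForm h' t) τ').a ∧
        ((a * d : ℕ) : ℤ) ∣ (smul (pairForm h' ((s.1 : ℤ), s.2)) τ').a)) : ℝ) ≤
      levelWeight h' (a * d) s t := by
  classical
  set q := a * d with hq'
  unfold levelWeight
  by_cases hcase : ((s.1 : ℤ), s.2) = t ∨ (q : ℤ) ∣ resPair h' ((s.1 : ℤ), s.2) t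
  · rw [if_pos hcase]
    -- at most the number of level cosets of `R_t`
    have h1 : #((leftTrans q).filter (fun τ' => (q : ℤ) ∣ (smul (pairForm h' t) τ').a ∧
        (q : ℤ) ∣ (smul (pairForm h' ((s.1 : ℤ), s.2)) τ').a)) ≤
        Nat.card {x : SL(2, ℤ) ⧸ CongruenceSubgroup.Gamma0 q // IsLevelCoset (pairForm h' t) q x} := by
      set T := (leftTrans q).filter (fun τ' => (q : ℤ) ∣ (smul (pairForm h' t) τ').a ∧
        (q : ℤ) ∣ (smul (pairForm h' ((s.1 : ℤ), s.2)) τ').a) with hT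
      let f : T → {x : SL(2, ℤ) ⧸ CongruenceSubgroup.Gamma0 q // IsLevelCoset (pairForm h' t) q x} :=
        fun ξ => ⟨(ξ.1 : SL(2, ℤ) ⧸ _), (isLevelCoset_mk_iff (pairForm h' t) ξ.1).2 (mem_filter.mp ξ.2).2.1⟩
      have hf : Function.Injective f := by
        rintro ⟨ξ, hξ⟩ ⟨ξ', hξ'⟩ h
        have h' : (ξ : SL(2, ℤ) ⧸ CongruenceSubgroup.Gamma0 q) = ξ' := congrArg Subtype.val h
        rw [QuotientGroup.eq] at h'
        have hξT := (mem_filter.mp hξ).1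
        have hξ'T := (mem_filter.mp hξ').1
        -- `ξ⁻¹ ξ' ∈ Γ₀(q)` and both in the transversal ⇒ equal
        obtain ⟨τ, -, huniq⟩ := leftTrans_existsUnique q ξ'
        have e1 := huniq ξ ⟨hξT, h'⟩
        have e2 := huniq ξ' ⟨hξ'T, by rw [inv_mul_cancel]; exact one_mem _⟩
        exact Subtype.ext (e1.trans e2.symm)
      rw [← Nat.card_eq_finsetCard T]
      exact Nat.card_le_card_of_injective f hf
    have h2 := card_levelCosets_le_sum (pairForm h' t) hq
    have h3 : ∑ e ∈ (Nat.gcd (pairForm h' t).a.natAbs q).divisors,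
        quadRootCount ((pairForm h' t).a / e) (pairForm h' t).b ((pairForm h' t).c * e) (q / e) =
        levelMultBound h' q t := by
      simp only [levelMultBound, pairForm, formC]
    exact_mod_cast h1.trans (h3 ▸ h2)
  · rw [if_neg hcase]
    have : (leftTrans q).filter (fun τ' => (q : ℤ) ∣ (smul (pairForm h' t) τ').a ∧
        (q : ℤ) ∣ (smul (pairForm h' ((s.1 : ℤ), s.2)) τ').a) = ∅ := by
      rw [Finset.eq_empty_iff_forall_notMem]
      intro τ' hτ'
      rw [mem_filter] at hτ'
      apply hcase
      right
      rw [← Res_pairForm]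
      exact dvd_Res_of_dvd_smul_a hτ'.2.2 hτ'.2.1
    rw [this, card_empty, Nat.cast_zero]

end kernelCount

section kernelMain

open RootForms
open Literature.NumberTheory.Automorphic (pointPairInv pointPairInv_smul pointPairInv_comm
  pointPairInv_nonneg automorphicKernel automorphicKernel_eq_sum finite_hypBall
  isDiscreteSubgroup_modular modular_le_range_toGL)

/-- `u(σz, σw) = u(z, w)` for `σ ∈ SL₂(ℤ)`. [folklore] -/
theorem pointPairInv_smul_sl2z (σ : SL(2, ℤ)) (z w : ℍ) :
    pointPairInv (σ • z) (σ • w) = pointPairInv z w := by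
  have e : ∀ x : ℍ, σ • x = (Matrix.SpecialLinearGroup.map (Int.castRingHom ℝ) σ : SL(2, ℝ)) • x :=
    fun x => rfl
  rw [e, e]
  exact pointPairInv_smul _ z w

/-- The finite set `{g ∈ SL₂(ℤ) : u(g·z', z) ≤ M}` (discreteness of `SL₂(ℤ)`). [folklore] -/
theorem finite_nearSet (z' z : ℍ) (M : ℝ) : {g : SL(2, ℤ) | pointPairInv (g • z') z ≤ M}.Finite := by
  have hfin := finite_hypBall (Γ := (𝒮ℒ : Subgroup (GL (Fin 2) ℝ))) modular_le_range_toGL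
    isDiscreteSubgroup_modular z' z M
  have hsub : {g : SL(2, ℤ) | pointPairInv (g • z') z ≤ M} ⊆
      (Matrix.SpecialLinearGroup.mapGL ℝ : SL(2, ℤ) → GL (Fin 2) ℝ) ⁻¹'
        {γ : GL (Fin 2) ℝ | γ ∈ (𝒮ℒ : Subgroup (GL (Fin 2) ℝ)) ∧ pointPairInv (γ • z') z ≤ M} := by
    intro g hg
    exact ⟨⟨g, rfl⟩, hg⟩
  refine Set.Finite.subset (hfin.preimage ?_) hsub
  exact DFI1995.mapGL_injective.injOn

/-- The near set as a `Finset`. [folklore] -/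
def nearSet (z' z : ℍ) (M : ℝ) : Finset SL(2, ℤ) := (finite_nearSet z' z M).toFinset

/-- Membership in `nearSet`. [folklore] -/
theorem mem_nearSet {z' z : ℍ} {M : ℝ} {g : SL(2, ℤ)} : g ∈ nearSet z' z M ↔ pointPairInv (g • z') z ≤ M := by
  unfold nearSet; rw [Set.Finite.mem_toFinset]; rfl

variable {a d : ℕ}

/-- **Step A — the kernel at two translated points as a sum over `SL₂(ℤ)`**:
`𝒦_{Γ₀(q)} k⁺_Z(τ'⁻¹z', τ⁻¹z) = ∑_{g : u(gz', z) ≤ Z+1} 𝟙[τ⁻¹gτ' ∈ Γ₀(q)] k⁺_Z(u(gz', z))`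
(`γ ↦ g = τγτ'⁻¹`). [cite: GrimmeltMerikoski2025, §4.1 (first display of the proof of Prop. 4.1)] -/
theorem automorphicKernel_translates_eq [NeZero (a * d)]
    [DecidablePred (· ∈ CongruenceSubgroup.Gamma0 (a * d))] (z' z : ℍ) (τ τ' : SL(2, ℤ)) (Z : ℝ) :
    automorphicKernel (Gamma0GL (a * d)) (kPlus Z) (τ'⁻¹ • z') (τ⁻¹ • z) =
      ∑ g ∈ nearSet z' z (Z + 1),
        (if τ⁻¹ * (g * τ') ∈ CongruenceSubgroup.Gamma0 (a * d) then (1 : ℝ) else 0) *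
          kPlus Z (pointPairInv (g • z') z) := by
  classical
  set q := a * d with hq
  set G := nearSet z' z (Z + 1) with hG
  set ι : SL(2, ℤ) → GL (Fin 2) ℝ := fun g => Matrix.SpecialLinearGroup.mapGL ℝ (τ⁻¹ * (g * τ')) with hι
  have hιinj : Function.Injective ι := by
    intro g g' h
    have := DFI1995.mapGL_injective h
    have := mul_left_cancel this
    exact mul_right_cancel this
  set S : Finset (GL (Fin 2) ℝ) := (G.filter (fun g => τ⁻¹ * (g * τ') ∈ CongruenceSubgroup.Gamma0 q)).image ι
    with hS
  have hM : ∀ u, Z + 1 ≤ u → kPlus Z u = 0 := fun u hu => kPlus_eq_zero_of_lt (by linarith)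
  -- the action of `ι g`
  have hact : ∀ g : SL(2, ℤ), pointPairInv (ι g • τ'⁻¹ • z') (τ⁻¹ • z) = pointPairInv (g • z') z := by
    intro g
    have e : ι g • τ'⁻¹ • z' = τ⁻¹ • g • z' := by
      show (τ⁻¹ * (g * τ')) • τ'⁻¹ • z' = _
      rw [smul_smul, mul_assoc, mul_assoc, mul_inv_cancel, mul_one, ← smul_smul]
    rw [e, pointPairInv_smul_sl2z]
  have hSΓ : (↑S : Set (GL (Fin 2) ℝ)) ⊆ Gamma0GL q := by
    intro γ hγ
    rw [mem_coe, hS, mem_image] at hγ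
    obtain ⟨g, hg, rfl⟩ := hγ
    rw [mem_filter] at hg
    rw [hι, SetLike.mem_coe, DFI1995.mapGL_mem_Gamma0GL_iff]
    exact hg.2
  have hsupp : ∀ γ ∈ Gamma0GL q, pointPairInv (γ • τ'⁻¹ • z') (τ⁻¹ • z) < Z + 1 → γ ∈ (↑S : Set (GL (Fin 2) ℝ)) := by
    intro γ hγ hu
    rw [DFI1995.mem_Gamma0GL_iff] at hγ
    obtain ⟨γ₀, hγ₀, rfl⟩ := hγ
    set g := τ * γ₀ * τ'⁻¹ with hg
    have hιg : ι g = Matrix.SpecialLinearGroup.mapGL ℝ γ₀ := by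
      rw [hι]; simp only []; congr 1; rw [hg]; group
    have hu' : pointPairInv (g • z') z < Z + 1 := by rwa [← hact g, hιg]
    rw [mem_coe, hS, mem_image]
    refine ⟨g, ?_, hιg⟩
    rw [mem_filter, hG, mem_nearSet]
    refine ⟨hu'.le, ?_⟩
    rw [hg, show τ⁻¹ * (τ * γ₀ * τ'⁻¹ * τ') = γ₀ by group]
    exact hγ₀
  rw [automorphicKernel_eq_sum hM _ _ S.finite_toSet hSΓ hsupp, Finset.finite_toSet_toFinset, hS,
    sum_image fun g _ g' _ h => hιinj h, sum_filter]
  refine sum_congr rfl fun g _ => ?_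
  split_ifs
  · rw [one_mul, hact]
  · rw [zero_mul]

/-- **Step D — summing over a class through its lifts**: for `F ≥ 0`,
`∑_{g ∈ G} F(R·g) ≤ |stab R| · ∑_{Q ∈ R·G} F(Q)`. [cite: GrimmeltMerikoski2025, (5.2) (the weights 1/|Γ_{σi}|)] -/
theorem sum_smul_le_card_stab_mul {R : BinQF} (hA : 0 < R.a) (hΔ : R.disc < 0) (G : Finset SL(2, ℤ))
    (F : BinQF → ℝ) (hF : ∀ Q, 0 ≤ F Q) :
    ∑ g ∈ G, F (smul R g) ≤ #(stabFinset R hA hΔ) * ∑ Q ∈ G.image (smul R), F Q := by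
  classical
  rw [← sum_fiberwise_of_maps_to (g := smul R) (fun g hg => mem_image_of_mem _ hg), mul_sum]
  refine sum_le_sum fun Q hQ => ?_
  have hconst : ∀ g ∈ G.filter (fun g => smul R g = Q), F (smul R g) = F Q := by
    intro g hg; rw [(mem_filter.mp hg).2]
  rw [sum_congr rfl hconst, sum_const, nsmul_eq_mul]
  refine mul_le_mul_of_nonneg_right ?_ (hF Q)
  obtain ⟨g₀, hg₀, rfl⟩ := mem_image.mp hQ
  -- the fibre injects into the stabiliser by `g ↦ g₀ g⁻¹`
  have : #(G.filter (fun g => smul R g = smul R g₀)) ≤ #(stabFinset R hA hΔ) := by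
    refine card_le_card_of_injOn (fun g => g₀ * g⁻¹) ?_ ?_
    · intro g hg
      rw [mem_coe, mem_filter] at hg
      rw [mem_coe, mem_stabFinset hA hΔ]
      exact smul_eq_smul_iff.mp hg.2
    · intro g _ g' _ h
      have := mul_left_cancel h
      exact inv_injective this
  exact_mod_cast this

/-- The pair `(A, B)` of a form, with `A` as a natural number. [folklore] -/
def toPair (Q : BinQF) : ℕ × ℤ := (Q.a.toNat, Q.b)

/-- A positive definite form of discriminant `−4h'` is `pairForm` of its pair. [folklore] -/
theorem pairForm_toPair {h' : ℕ} {Q : BinQF} (hA : 0 < Q.a) (hdisc : Q.disc = -(4 * (h' : ℤ))) :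
    pairForm h' (((toPair Q).1 : ℤ), (toPair Q).2) = Q := by
  have hA' : ((Q.a.toNat : ℕ) : ℤ) = Q.a := Int.toNat_of_nonneg hA.le
  have hCR : 4 * Q.a * Q.c = Q.b ^ 2 + 4 * (h' : ℤ) := by
    rw [BinQF.disc] at hdisc; linarith
  cases hQ : Q with
  | mk A B C =>
    rw [hQ] at hA' hCR hA
    simp only [toPair, pairForm, BinQF.mk.injEq] at hA' hCR hA ⊢
    refine ⟨hA', trivial, ?_⟩
    rw [hA', ← hCR, show 4 * A * C = (4 * A) * C by ring, Int.mul_ediv_cancel_left _ (by positivity)]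

/-- **Step E — from the class to the box**: for `F ≥ 0` vanishing, among the positive definite
forms of discriminant `−4h'`, outside the box `A ≤ N`, `|B| ≤ N'`:
`∑_{Q ∈ R·G} F(Q) ≤ ∑_{s ∈ discPairs h' N N', lrep(P_s) = lrep R} F(P_s)`. [folklore] -/
theorem sum_image_smul_le_sum_discPairs {h' : ℕ} (hh' : 0 < h') {R : BinQF} (hA : 0 < R.a)
    (hdisc : R.disc = -(4 * (h' : ℤ))) (G : Finset SL(2, ℤ)) (F : BinQF → ℝ) (hF : ∀ Q, 0 ≤ F Q)
    {N N' : ℕ} (hsupp : ∀ Q : BinQF, 0 < Q.a → Q.disc = -(4 * (h' : ℤ)) → F Q ≠ 0 → Q.a ≤ N ∧ |Q.b| ≤ N') :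
    ∑ Q ∈ G.image (smul R), F Q ≤
      ∑ s ∈ (discPairs h' N N').filter (fun s => lrep (pairForm h' ((s.1 : ℤ), s.2)) = lrep R),
        F (pairForm h' ((s.1 : ℤ), s.2)) := by
  classical
  have hΔ : R.disc < 0 := by rw [hdisc, neg_lt_zero]; positivity
  set I := (G.image (smul R)).filter (fun Q => F Q ≠ 0) with hI
  have hmemI : ∀ Q ∈ I, 0 < Q.a ∧ Q.disc = -(4 * (h' : ℤ)) ∧ F Q ≠ 0 ∧ lrep Q = lrep R := by
    intro Q hQ
    rw [hI, mem_filter, mem_image] at hQ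
    obtain ⟨⟨g, -, rfl⟩, hne⟩ := hQ
    exact ⟨smul_a_pos_of_definite hA hΔ g, by rw [smul_disc, hdisc], hne, lrep_smul R g⟩
  calc ∑ Q ∈ G.image (smul R), F Q = ∑ Q ∈ I, F Q := by
        rw [hI, sum_filter_ne_zero]
    _ = ∑ s ∈ I.image toPair, F (pairForm h' ((s.1 : ℤ), s.2)) := by
        rw [sum_image]
        · refine sum_congr rfl fun Q hQ => ?_
          obtain ⟨hQA, hQd, -, -⟩ := hmemI Q hQ
          rw [pairForm_toPair hQA hQd]
        · intro Q hQ Q' hQ' h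
          obtain ⟨hQA, hQd, -, -⟩ := hmemI Q hQ
          obtain ⟨hQA', hQd', -, -⟩ := hmemI Q' hQ'
          rw [← pairForm_toPair hQA hQd, ← pairForm_toPair hQA' hQd', h]
    _ ≤ _ := by
        refine sum_le_sum_of_subset_of_nonneg ?_ (fun s _ _ => hF _)
        intro s hs
        obtain ⟨Q, hQ, rfl⟩ := mem_image.mp hs
        obtain ⟨hQA, hQd, hne, hcl⟩ := hmemI Q hQ
        obtain ⟨hN, hN'⟩ := hsupp Q hQA hQd hne
        rw [mem_filter, pairForm_toPair hQA hQd]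
        refine ⟨?_, hcl⟩
        unfold discPairs
        rw [mem_filter, mem_product, mem_Icc, mem_Icc]
        have hA' : ((Q.a.toNat : ℕ) : ℤ) = Q.a := Int.toNat_of_nonneg hQA.le
        refine ⟨⟨⟨?_, ?_⟩, abs_le.mp hN'⟩, ?_⟩
        · have : 1 ≤ Q.a.toNat := by omega
          exact this
        · have : (Q.a.toNat : ℤ) ≤ N := by rw [hA']; exact hN
          exact_mod_cast this
        · show 4 * ((Q.a.toNat : ℕ) : ℤ) ∣ (toPair Q).2 ^ 2 + 4 * (h' : ℤ)
          rw [hA']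
          refine ⟨Q.c, ?_⟩
          have := hQd; rw [BinQF.disc] at this
          show Q.b ^ 2 + 4 * (h' : ℤ) = 4 * Q.a * Q.c
          linarith

end kernelMain

section kernelAssembly

open RootForms
open Literature.NumberTheory.Automorphic (pointPairInv pointPairInv_comm pointPairInv_nonneg automorphicKernel)

/-- Members of `heegnerReps h'` have `1 ≤ A ≤ 2h'` and `|B| ≤ A`. [folklore] -/
theorem bounds_of_mem_heegnerReps {h' : ℕ} (hh' : 0 < h') {t : ℤ × ℤ} (ht : t ∈ heegnerReps h') :
    1 ≤ t.1 ∧ t.1 ≤ 2 * (h' : ℤ) ∧ |t.2| ≤ t.1 := by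
  obtain ⟨h1, -, hB, -, h3⟩ := mem_heegnerReps ht
  refine ⟨h1, ?_, hB⟩
  have hh1 : (1 : ℤ) ≤ h' := by exact_mod_cast hh'
  nlinarith

/-- **Support box**: if `k⁺_Z(u(z_Q, z_t)) ≠ 0` for a reduced `t`, then `A_Q ≤ 8(1+Z)h'` and
`|B_Q| ≤ 24(1+Z)h'²`. [cite: GrimmeltMerikoski2025, §4.1.2 ("𝔠₁ ≪ Z𝔠₂ ≪ Z h^{1/2} and |𝔟₁| ≪ Z h^{1/2}")] -/
theorem box_of_uPair_le {h' : ℕ} (hh' : 0 < h') {Q : BinQF} (hQA : 0 < Q.a) {t : ℤ × ℤ}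
    (ht : t ∈ heegnerReps h') {Z : ℝ} (hZ : 0 ≤ Z) (hu : uPair h' (Q.a, Q.b) t ≤ Z) :
    (Q.a : ℝ) ≤ 8 * (1 + Z) * h' ∧ (|Q.b| : ℝ) ≤ 24 * (1 + Z) * (h' : ℝ) ^ 2 := by
  obtain ⟨ht1, ht2, htB⟩ := bounds_of_mem_heegnerReps hh' ht
  have ht0 : 0 < t.1 := by omega
  have hA := fst_le_of_uPair_le hh' (s := (Q.a, Q.b)) hQA ht0 hu
  obtain ⟨hX, -⟩ := sq_le_of_uPair_le hh' (s := (Q.a, Q.b)) hQA ht0 hu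
  simp only [] at hA hX
  have ht1' : (1 : ℝ) ≤ t.1 := by exact_mod_cast ht1
  have ht2' : (t.1 : ℝ) ≤ 2 * h' := by exact_mod_cast ht2
  have htB' : (|t.2| : ℝ) ≤ t.1 := by
    have : ((|t.2| : ℤ) : ℝ) ≤ t.1 := by exact_mod_cast htB
    push_cast at this; exact this
  have hh1 : (1 : ℝ) ≤ h' := by exact_mod_cast hh'
  have hQA' : (0 : ℝ) < Q.a := by exact_mod_cast hQA
  have hAle : (Q.a : ℝ) ≤ 8 * (1 + Z) * h' := by nlinarith
  refine ⟨hAle, ?_⟩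
  -- `|B t₁ − t₂ A| ≤ 16 (1+Z) h'²`
  set X : ℝ := ((Q.b * t.1 - t.2 * Q.a : ℤ) : ℝ) with hXdef
  have hW : X ^ 2 ≤ (16 * (1 + Z) * (h' : ℝ) ^ 2) ^ 2 := by
    have h1 : (16 : ℝ) * h' * Z * Q.a * t.1 ≤ 16 * h' * Z * (8 * (1 + Z) * h') * (2 * h') := by
      have : (0 : ℝ) ≤ 16 * h' * Z := by positivity
      calc (16 : ℝ) * h' * Z * Q.a * t.1 ≤ 16 * h' * Z * (8 * (1 + Z) * h') * t.1 := by
            gcongr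
        _ ≤ 16 * h' * Z * (8 * (1 + Z) * h') * (2 * h') := by
            gcongr
    have h2 : (16 : ℝ) * h' * Z * (8 * (1 + Z) * h') * (2 * h') ≤ (16 * (1 + Z) * (h' : ℝ) ^ 2) ^ 2 := by
      have hZ1 : Z ≤ 1 + Z := by linarith
      have hh3 : (h' : ℝ) ^ 3 ≤ (h' : ℝ) ^ 4 := pow_le_pow_right₀ hh1 (by norm_num)
      nlinarith [mul_le_mul_of_nonneg_right hZ1 (by positivity : (0 : ℝ) ≤ (1 + Z) * (h' : ℝ) ^ 3)]
    linarith
  have hXabs : |X| ≤ 16 * (1 + Z) * (h' : ℝ) ^ 2 := abs_le_of_sq_le_sq' hW (by positivity) |>.elim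
    (fun h1 h2 => abs_le.mpr ⟨h1, h2⟩)
  -- `|B| t₁ ≤ |t₂| A + |X| ≤ t₁ A + |X|`
  have hB1 : (|Q.b| : ℝ) * t.1 ≤ t.1 * Q.a + 16 * (1 + Z) * (h' : ℝ) ^ 2 := by
    have e : (Q.b : ℝ) * t.1 = X + t.2 * Q.a := by rw [hXdef]; push_cast; ring
    calc (|Q.b| : ℝ) * t.1 = |(Q.b : ℝ) * t.1| := by
          rw [abs_mul, abs_of_pos (by linarith : (0 : ℝ) < t.1)]
      _ = |X + t.2 * Q.a| := by rw [e]
      _ ≤ |X| + |(t.2 : ℝ) * Q.a| := abs_add_le _ _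
      _ = |X| + |(t.2 : ℝ)| * Q.a := by rw [abs_mul, abs_of_pos hQA']
      _ ≤ 16 * (1 + Z) * (h' : ℝ) ^ 2 + t.1 * Q.a := by
          have : |(t.2 : ℝ)| * Q.a ≤ t.1 * Q.a := mul_le_mul_of_nonneg_right htB' hQA'.le
          linarith
      _ = _ := by ring
  have hB2 : (|Q.b| : ℝ) ≤ Q.a + 16 * (1 + Z) * (h' : ℝ) ^ 2 := by
    have hpos : (0 : ℝ) < t.1 := by linarith
    have : (|Q.b| : ℝ) * t.1 ≤ (Q.a + 16 * (1 + Z) * (h' : ℝ) ^ 2) * t.1 := by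
      have h0 : (0 : ℝ) ≤ 16 * (1 + Z) * (h' : ℝ) ^ 2 := by positivity
      nlinarith
    exact le_of_mul_le_mul_right this hpos
  have : (Q.a : ℝ) ≤ 8 * (1 + Z) * (h' : ℝ) ^ 2 := by
    calc (Q.a : ℝ) ≤ 8 * (1 + Z) * h' := hAle
      _ ≤ 8 * (1 + Z) * (h' : ℝ) ^ 2 := by
          have : (h' : ℝ) ≤ (h' : ℝ) ^ 2 := by nlinarith
          have : (0 : ℝ) ≤ 8 * (1 + Z) := by positivity
          nlinarith
  linarith

/-- A Lagrange-reduced positive definite form of discriminant `−4h'` is `pairForm` of a member of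
`heegnerReps h'`. [folklore] -/
theorem mem_heegnerReps_of_reduced {h' : ℕ} (hh' : 0 < h') {R : BinQF} (hred : IsLagrangeReduced R)
    (hpos : 0 < R.a) (hdiscR : R.disc = -(4 * (h' : ℤ))) :
    (R.a, R.b) ∈ heegnerReps h' ∧ pairForm h' (R.a, R.b) = R := by
  have hCR : 4 * R.a * R.c = R.b ^ 2 + 4 * (h' : ℤ) := by
    have := hdiscR; rw [BinQF.disc] at this; linarith
  obtain ⟨hb, hc⟩ := hred
  rw [abs_of_pos hpos] at hb hc
  have hCpos : 0 < R.c := by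
    by_contra hle
    have hle' : R.c ≤ 0 := not_lt.mp hle
    have : R.a * R.c ≤ 0 := mul_nonpos_of_nonneg_of_nonpos hpos.le hle'
    have : (0 : ℤ) < h' := by exact_mod_cast hh'
    nlinarith [sq_nonneg R.b]
  rw [abs_of_pos hCpos] at hc
  have hBB : R.b ^ 2 ≤ R.a ^ 2 := by
    have := abs_le.mp hb
    nlinarith
  have hAC : R.a * R.a ≤ R.a * R.c := mul_le_mul_of_nonneg_left hc hpos.le
  have hA1 : R.a ≤ R.a ^ 2 := by nlinarith
  have hM : (0 : ℤ) < h' := by exact_mod_cast hh'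
  have hA2 : R.a ≤ 2 * (h' : ℤ) := by nlinarith
  constructor
  · unfold heegnerReps
    rw [mem_filter, mem_product, mem_Icc, mem_Icc]
    simp only []
    have := abs_le.mp hb
    refine ⟨⟨⟨by omega, by linarith⟩, by linarith, by linarith⟩, ⟨R.c, by linarith⟩, hb, by linarith⟩
  · cases hR : R with
    | mk A B C =>
      rw [hR] at hCR hpos
      simp only [pairForm, BinQF.mk.injEq, true_and]
      simp only at hCR hpos
      rw [← hCR, show 4 * A * C = (4 * A) * C by ring, Int.mul_ediv_cancel_left _ (by positivity)]

/-- Members of `repsCan a h`: reduced, so given by a member of `heegnerReps (a h)`. [folklore] -/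
theorem repsCan_pair {a h : ℕ} (ha : 0 < a) (hh : 0 < h) {R : BinQF} (hR : R ∈ repsCan a h) :
    (R.a, R.b) ∈ heegnerReps (a * h) ∧ pairForm (a * h) (R.a, R.b) = R := by
  obtain ⟨hRA, hRdisc, -⟩ := repsCan_spec ha hh hR
  have hΔ : R.disc < 0 := by rw [hRdisc, neg_lt_zero]; positivity
  -- `R = lrep R₀` is Lagrange-reduced
  have hred : IsLagrangeReduced R := by
    unfold repsCan at hR
    obtain ⟨R₀, hR₀, rfl⟩ := mem_image.mp hR
    obtain ⟨t, ht, rfl⟩ := mem_image.mp hR₀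
    obtain ⟨ht1, ht4, -, -, -⟩ := mem_heegnerReps ht
    have hA0 : 0 < (pairForm (a * h) t).a := by show 0 < t.1; omega
    have hdisc0 : (pairForm (a * h) t).disc = -(4 * (a : ℤ) * h) := by
      have := Int.mul_ediv_cancel' ht4
      simp only [pairForm, BinQF.disc]
      push_cast at this ⊢
      linarith
    have hΔ0 : (pairForm (a * h) t).disc < 0 := by rw [hdisc0, neg_lt_zero]; positivity
    exact (lrep_spec hA0 hΔ0).1
  have hdisc' : R.disc = -(4 * ((a * h : ℕ) : ℤ)) := by rw [hRdisc]; push_cast; ring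
  exact mem_heegnerReps_of_reduced (Nat.mul_pos ha hh) hred hRA hdisc'

variable {a h d : ℕ}

/-- Sums over `heegPairs` as iterated sums over representatives and the transversal. [folklore] -/
theorem sum_heegPairs_eq (φ : BinQF × SL(2, ℤ) → ℝ) :
    ∑ p ∈ heegPairs a h d, φ p =
      ∑ R ∈ repsCan a h, ∑ τ ∈ (leftTrans (a * d)).filter
        (fun τ => ((a * d : ℕ) : ℤ) ∣ (smul R τ).a ∧ 2 * (a : ℤ) ∣ (smul R τ).b), φ (R, τ) := by
  unfold heegPairs
  rw [sum_filter, sum_product]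
  refine sum_congr rfl fun R _ => ?_
  rw [sum_filter]

/-- **The per-pair-of-classes bound** (Steps A–E and G): for canonical representatives `R, R'`,
`∑_{τ, τ' level} 𝒦_{Γ₀(q)} k⁺_Z(τ'⁻¹ z_{R'}, τ⁻¹ z_R) ≤ |stab R| ∑_{s ∈ discPairs, cl(s) = R} k⁺_Z(u(s, t_{R'})) levelWeight_q(s, t_{R'})`.
[cite: GrimmeltMerikoski2025, §4.1 (proof of Proposition 4.1, first display)] -/
theorem classPair_kernel_le (ha : 0 < a) (hh : 0 < h) (hd : 0 < d) [NeZero (a * d)]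
    {R R' : BinQF} (hR : R ∈ repsCan a h) (hR' : R' ∈ repsCan a h)
    (hRA : 0 < R.a) (hRΔ : R.disc < 0) (hR'A : 0 < R'.a) (hR'Δ : R'.disc < 0)
    {Z : ℝ} (hZ : 0 ≤ Z) {N N' : ℕ} (hN : 8 * (1 + Z) * ((a * h : ℕ) : ℝ) ≤ N)
    (hN' : 24 * (1 + Z) * ((a * h : ℕ) : ℝ) ^ 2 ≤ N') :
    ∑ τ ∈ (leftTrans (a * d)).filter
        (fun τ => ((a * d : ℕ) : ℤ) ∣ (smul R τ).a ∧ 2 * (a : ℤ) ∣ (smul R τ).b),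
      ∑ τ' ∈ (leftTrans (a * d)).filter
        (fun τ' => ((a * d : ℕ) : ℤ) ∣ (smul R' τ').a ∧ 2 * (a : ℤ) ∣ (smul R' τ').b),
        automorphicKernel (Gamma0GL (a * d)) (kPlus Z)
          (τ'⁻¹ • heegnerPt R' hR'A hR'Δ) (τ⁻¹ • heegnerPt R hRA hRΔ) ≤
      #(stabFinset R hRA hRΔ) *
        ∑ s ∈ (discPairs (a * h) N N').filter (fun s => lrep (pairForm (a * h) ((s.1 : ℤ), s.2)) = R),
          kPlus Z (uPair (a * h) ((s.1 : ℤ), s.2) (R'.a, R'.b)) * levelWeight (a * h) (a * d) s (R'.a, R'.b) := by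
  classical
  obtain ⟨-, hRdisc, hRfix⟩ := repsCan_spec ha hh hR
  obtain ⟨-, hR'disc, -⟩ := repsCan_spec ha hh hR'
  obtain ⟨ht'mem, hR'form⟩ := repsCan_pair ha hh hR'
  set q := a * d with hq
  have hq0 : 0 < q := Nat.mul_pos ha hd
  set h' := a * h with hh'
  have hh'0 : 0 < h' := Nat.mul_pos ha hh
  set t' : ℤ × ℤ := (R'.a, R'.b) with ht'
  set z := heegnerPt R hRA hRΔ with hz
  set z' := heegnerPt R' hR'A hR'Δ with hz'
  set T := leftTrans q with hT
  set lvl : BinQF → SL(2, ℤ) → Prop := fun P τ => (q : ℤ) ∣ (smul P τ).a ∧ 2 * (a : ℤ) ∣ (smul P τ).b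
    with hlvl
  set G := nearSet z' z (Z + 1) with hG
  -- the count and the majorant `F`
  set cnt : BinQF → ℝ := fun Q => #(T.filter (fun τ' => (q : ℤ) ∣ (smul (pairForm h' t') τ').a ∧
      (q : ℤ) ∣ (smul Q τ').a)) with hcnt
  set F : BinQF → ℝ := fun Q => kPlus Z (uPair h' (Q.a, Q.b) t') * cnt Q with hF
  have hcnt0 : ∀ Q, 0 ≤ cnt Q := fun Q => by rw [hcnt]; exact Nat.cast_nonneg _
  have hF0 : ∀ Q, 0 ≤ F Q := fun Q => mul_nonneg (kPlus_nonneg _ _) (hcnt0 Q)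
  have hdiscR : R.disc = -(4 * (h' : ℤ)) := by rw [hRdisc, hh']; push_cast; ring
  have hdiscR' : R'.disc = -(4 * (h' : ℤ)) := by rw [hR'disc, hh']; push_cast; ring
  -- Step A + B + C: the double sum is at most `∑_{g ∈ G} F (R·g)`
  have step1 : ∑ τ ∈ T.filter (lvl R), ∑ τ' ∈ T.filter (lvl R'),
      automorphicKernel (Gamma0GL q) (kPlus Z) (τ'⁻¹ • z') (τ⁻¹ • z) ≤ ∑ g ∈ G, F (smul R g) := by
    -- expand the kernel
    have hexp : ∀ τ τ' : SL(2, ℤ), automorphicKernel (Gamma0GL q) (kPlus Z) (τ'⁻¹ • z') (τ⁻¹ • z) =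
        ∑ g ∈ G, (if τ⁻¹ * (g * τ') ∈ CongruenceSubgroup.Gamma0 q then (1 : ℝ) else 0) *
          kPlus Z (pointPairInv (g • z') z) := fun τ τ' => automorphicKernel_translates_eq z' z τ τ' Z
    simp_rw [hexp]
    -- reorder: `∑_τ ∑_τ' ∑_g = ∑_g ∑_τ' ∑_τ`
    rw [sum_comm]
    simp_rw [sum_comm (s := T.filter (lvl R)) (t := G)]
    rw [sum_comm]
    refine sum_le_sum fun g hg => ?_
    -- the kernel value in arithmetic form
    have hk : kPlus Z (pointPairInv (g • z') z) = kPlus Z (uPair h' ((smul R g).a, (smul R g).b) t') := by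
      congr 1
      rw [← pointPairInv_smul_sl2z g⁻¹, inv_smul_smul, hz, ← heegnerPt_smul hRA hRΔ g,
        pointPairInv_comm, ht']
      exact pointPairInv_heegnerPt hh'0 _ _ hR'A hR'Δ (by rw [smul_disc, hdiscR]) hdiscR'
    calc ∑ τ' ∈ T.filter (lvl R'), ∑ τ ∈ T.filter (lvl R),
          (if τ⁻¹ * (g * τ') ∈ CongruenceSubgroup.Gamma0 q then (1 : ℝ) else 0) *
            kPlus Z (pointPairInv (g • z') z)
        = kPlus Z (pointPairInv (g • z') z) * ∑ τ' ∈ T.filter (lvl R'), ∑ τ ∈ T.filter (lvl R),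
          (if τ⁻¹ * (g * τ') ∈ CongruenceSubgroup.Gamma0 q then (1 : ℝ) else 0) := by
          rw [mul_sum]; refine sum_congr rfl fun τ' _ => ?_; rw [mul_sum]
          refine sum_congr rfl fun τ _ => ?_; ring
      _ ≤ kPlus Z (pointPairInv (g • z') z) * ∑ τ' ∈ T.filter (lvl R'),
          (if (q : ℤ) ∣ (smul (smul R g) τ').a then (1 : ℝ) else 0) := by
          refine mul_le_mul_of_nonneg_left (sum_le_sum fun τ' _ => ?_) (kPlus_nonneg _ _)
          exact sum_transversal_indicator_le R g τ'
      _ ≤ kPlus Z (pointPairInv (g • z') z) * cnt (smul R g) := by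
          refine mul_le_mul_of_nonneg_left ?_ (kPlus_nonneg _ _)
          rw [hcnt]; simp only []
          rw [← sum_boole]
          -- compare filters: `lvl R' τ'` implies `q ∣ (R'·τ').a`, and `R' = pairForm t'`
          rw [sum_filter, hR'form]
          refine sum_le_sum fun τ' _ => ?_
          by_cases h1 : lvl R' τ'
          · rw [if_pos h1]
            by_cases h2 : (q : ℤ) ∣ (smul (smul R g) τ').a
            · rw [if_pos h2, if_pos ⟨h1.1, h2⟩]
            · rw [if_neg h2]; split_ifs <;> norm_num
          · rw [if_neg h1]; split_ifs <;> norm_num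
      _ = F (smul R g) := by rw [hF]; simp only []; rw [hk]
  -- Step D
  have step2 : ∑ g ∈ G, F (smul R g) ≤ #(stabFinset R hRA hRΔ) * ∑ Q ∈ G.image (smul R), F Q :=
    sum_smul_le_card_stab_mul hRA hRΔ G F hF0
  -- Step E (support box)
  have hsupp : ∀ Q : BinQF, 0 < Q.a → Q.disc = -(4 * (h' : ℤ)) → F Q ≠ 0 → Q.a ≤ N ∧ |Q.b| ≤ N' := by
    intro Q hQA hQd hne
    have hk : kPlus Z (uPair h' (Q.a, Q.b) t') ≠ 0 := left_ne_zero_of_mul hne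
    have hu : uPair h' (Q.a, Q.b) t' ≤ Z := by
      by_contra hlt
      exact hk (kPlus_eq_zero_of_lt (not_le.mp hlt))
    obtain ⟨hA, hB⟩ := box_of_uPair_le hh'0 hQA ht'mem hZ hu
    constructor
    · exact_mod_cast hA.trans hN
    · have : ((|Q.b| : ℤ) : ℝ) ≤ (N' : ℝ) := by push_cast; exact hB.trans hN'
      exact_mod_cast this
  have step3 := sum_image_smul_le_sum_discPairs hh'0 hRA hdiscR G F hF0 hsupp
  rw [hRfix] at step3
  -- Step G: `cnt ≤ levelWeight`
  have step4 : ∑ s ∈ (discPairs h' N N').filter (fun s => lrep (pairForm h' ((s.1 : ℤ), s.2)) = R),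
      F (pairForm h' ((s.1 : ℤ), s.2)) ≤
      ∑ s ∈ (discPairs h' N N').filter (fun s => lrep (pairForm h' ((s.1 : ℤ), s.2)) = R),
        kPlus Z (uPair h' ((s.1 : ℤ), s.2) t') * levelWeight h' q s t' := by
    refine sum_le_sum fun s _ => ?_
    rw [hF]; simp only [pairForm]
    refine mul_le_mul_of_nonneg_left ?_ (kPlus_nonneg _ _)
    rw [hcnt]; simp only []
    exact card_commonLevel_le_levelWeight hq0 h' t' s
  have hcard0 : (0 : ℝ) ≤ #(stabFinset R hRA hRΔ) := Nat.cast_nonneg _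
  calc _ ≤ ∑ g ∈ G, F (smul R g) := step1
    _ ≤ #(stabFinset R hRA hRΔ) * ∑ Q ∈ G.image (smul R), F Q := step2
    _ ≤ #(stabFinset R hRA hRΔ) * _ := mul_le_mul_of_nonneg_left step3 hcard0
    _ ≤ _ := mul_le_mul_of_nonneg_left step4 hcard0

end kernelAssembly

section kernelAssembly2

open RootForms
open Literature.NumberTheory.Automorphic (pointPairInv automorphicKernel)

variable {a h d : ℕ}

/-- `pairWt ≤ 1`. [folklore] -/
theorem pairWt_le_one (p : BinQF × SL(2, ℤ)) : pairWt p ≤ 1 := by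
  unfold pairWt
  split_ifs with hR
  · have : 1 ≤ #(stabFinset p.1 hR.1 hR.2) := card_pos.mpr ⟨1, one_mem_stabFinset hR.1 hR.2⟩
    have : (1 : ℝ) ≤ #(stabFinset p.1 hR.1 hR.2) := by exact_mod_cast this
    exact inv_le_one_of_one_le₀ this
  · exact zero_le_one

/-- For `s ∈ discPairs (ah) N N'`: the form `P_s` is positive definite of discriminant `−4ah`, so
`lrep P_s ∈ repsCan a h`. [folklore] -/
theorem lrep_pairForm_mem_repsCan (ha : 0 < a) (hh : 0 < h) {N N' : ℕ} {s : ℕ × ℤ}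
    (hs : s ∈ discPairs (a * h) N N') : lrep (pairForm (a * h) ((s.1 : ℤ), s.2)) ∈ repsCan a h := by
  rw [mem_discPairs] at hs
  obtain ⟨⟨hs1, -⟩, -, hs4⟩ := hs
  have hA : 0 < (pairForm (a * h) ((s.1 : ℤ), s.2)).a := by show (0 : ℤ) < s.1; exact_mod_cast hs1
  refine lrep_mem_repsCan ha hh hA ?_
  have := Int.mul_ediv_cancel' hs4
  simp only [pairForm, BinQF.disc]
  push_cast at this ⊢
  linarith

/-- **`K₂` in arithmetic form (the `q`-th summand)**: with the Heegner data `(S, b)` of level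
`q = ad` of `heegPairs` (points `τ⁻¹z_R`, weights `|stab R|⁻¹`),
`∑_{p, p'} b_p b_{p'} 𝒦_{Γ₀(q)} k⁺_Z(w_{p'}, w_p) ≤ ∑_{t ∈ Λ} ∑_{s ∈ 𝒮 (box)} k⁺_Z(u(z_s, z_t)) · levelWeight_q(s, t)`,
the right-hand side being the `q`-th summand of `heegnerKernel_sum_le` (Proposition 4.1).  This is
the first display of the proof of [GrimmeltMerikoski2025, Prop. 4.1]
(`⟨α_q|𝒦_q k|α_q⟩ = ∑_{z₂ ∈ Λ_h} ∑_{w₁ ∈ 𝒮_h} k(w₁, z₂) ∑_{τ ∈ T_q} α_q(τw₁) α_q(τz₂)`, weights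
`|Γ_z|⁻¹ ≤ 1`) combined with the bounds of §4.1.1–4.1.2 for the `τ`-count.
[cite: GrimmeltMerikoski2025, §4.1 (proof of Proposition 4.1) and §5 (K₂)] -/
theorem kernelSide_le (ha : 0 < a) (hh : 0 < h) (hd : 0 < d) [NeZero (a * d)]
    {Z : ℝ} (hZ : 0 ≤ Z) {N N' : ℕ} (hN : 8 * (1 + Z) * ((a * h : ℕ) : ℝ) ≤ N)
    (hN' : 24 * (1 + Z) * ((a * h : ℕ) : ℝ) ^ 2 ≤ N') :
    ∑ p ∈ heegPairs a h d, ∑ p' ∈ heegPairs a h d,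
        pairWt p * pairWt p' * automorphicKernel (Gamma0GL (a * d)) (kPlus Z) (pairPt p') (pairPt p) ≤
      ∑ t ∈ heegnerReps (a * h), ∑ s ∈ discPairs (a * h) N N',
        kPlus Z (uPair (a * h) ((s.1 : ℤ), s.2) t) * levelWeight (a * h) (a * d) s t := by
  classical
  set q := a * d with hq
  set DP := discPairs (a * h) N N' with hDP
  set K : ℕ × ℤ → ℤ × ℤ → ℝ := fun s t =>
    kPlus Z (uPair (a * h) ((s.1 : ℤ), s.2) t) * levelWeight (a * h) q s t with hK
  have hK0 : ∀ s t, 0 ≤ K s t := fun s t => mul_nonneg (kPlus_nonneg _ _) (levelWeight_nonneg _ _ _ _)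
  set lv : BinQF → SL(2, ℤ) → Prop := fun P τ => (q : ℤ) ∣ (smul P τ).a ∧ 2 * (a : ℤ) ∣ (smul P τ).b
    with hlv
  -- Step 1: iterate the sums and bound each pair of classes
  have step1 : ∀ R ∈ repsCan a h, ∀ R' ∈ repsCan a h,
      ∑ τ ∈ (leftTrans q).filter (lv R), ∑ τ' ∈ (leftTrans q).filter (lv R'),
        pairWt (R, τ) * pairWt (R', τ') *
          automorphicKernel (Gamma0GL q) (kPlus Z) (pairPt (R', τ')) (pairPt (R, τ)) ≤
      pairWt (R', 1) * ∑ s ∈ DP.filter (fun s => lrep (pairForm (a * h) ((s.1 : ℤ), s.2)) = R),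
        K s (R'.a, R'.b) := by
    intro R hR R' hR'
    obtain ⟨hRA, hRdisc, -⟩ := repsCan_spec ha hh hR
    obtain ⟨hR'A, hR'disc, -⟩ := repsCan_spec ha hh hR'
    have hRΔ : R.disc < 0 := by rw [hRdisc, neg_lt_zero]; positivity
    have hR'Δ : R'.disc < 0 := by rw [hR'disc, neg_lt_zero]; positivity
    have hwt : ∀ τ, pairWt (R, τ) = (#(stabFinset R hRA hRΔ) : ℝ)⁻¹ := fun τ => by
      unfold pairWt; rw [dif_pos ⟨hRA, hRΔ⟩]
    have hwt' : ∀ τ', pairWt (R', τ') = pairWt (R', 1) := fun τ' => rfl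
    have hpt : ∀ τ, pairPt (R, τ) = τ⁻¹ • heegnerPt R hRA hRΔ := fun τ => by
      unfold pairPt; rw [dif_pos ⟨hRA, hRΔ⟩]
    have hpt' : ∀ τ', pairPt (R', τ') = τ'⁻¹ • heegnerPt R' hR'A hR'Δ := fun τ' => by
      unfold pairPt; rw [dif_pos ⟨hR'A, hR'Δ⟩]
    simp_rw [hwt, hwt', hpt, hpt', mul_assoc, ← mul_sum]
    rw [mul_comm, mul_assoc]
    refine mul_le_mul_of_nonneg_left ?_ (pairWt_nonneg _)
    have hmain := classPair_kernel_le ha hh hd hR hR' hRA hRΔ hR'A hR'Δ hZ hN hN'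
    have hcard : (0 : ℝ) < #(stabFinset R hRA hRΔ) := by
      have : 0 < #(stabFinset R hRA hRΔ) := card_pos.mpr ⟨1, one_mem_stabFinset hRA hRΔ⟩
      exact_mod_cast this
    calc (∑ τ ∈ (leftTrans q).filter (lv R), ∑ τ' ∈ (leftTrans q).filter (lv R'),
          automorphicKernel (Gamma0GL q) (kPlus Z) (τ'⁻¹ • heegnerPt R' hR'A hR'Δ)
            (τ⁻¹ • heegnerPt R hRA hRΔ)) * (#(stabFinset R hRA hRΔ) : ℝ)⁻¹
        ≤ (#(stabFinset R hRA hRΔ) * ∑ s ∈ DP.filter (fun s => lrep (pairForm (a * h) ((s.1 : ℤ), s.2)) = R),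
            K s (R'.a, R'.b)) * (#(stabFinset R hRA hRΔ) : ℝ)⁻¹ :=
          mul_le_mul_of_nonneg_right hmain (inv_nonneg.mpr hcard.le)
      _ = _ := by field_simp
  -- Step 2: sum over `R`, `R'`
  have step2 : ∑ p ∈ heegPairs a h d, ∑ p' ∈ heegPairs a h d,
      pairWt p * pairWt p' * automorphicKernel (Gamma0GL q) (kPlus Z) (pairPt p') (pairPt p) ≤
      ∑ R' ∈ repsCan a h, pairWt (R', 1) * ∑ s ∈ DP, K s (R'.a, R'.b) := by
    simp_rw [sum_heegPairs_eq]
    -- swap `∑_τ` and `∑_{R'}`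
    have e1 : ∀ R ∈ repsCan a h,
        ∑ τ ∈ (leftTrans q).filter (lv R), ∑ R' ∈ repsCan a h, ∑ τ' ∈ (leftTrans q).filter (lv R'),
          pairWt (R, τ) * pairWt (R', τ') *
            automorphicKernel (Gamma0GL q) (kPlus Z) (pairPt (R', τ')) (pairPt (R, τ)) ≤
        ∑ R' ∈ repsCan a h, pairWt (R', 1) *
          ∑ s ∈ DP.filter (fun s => lrep (pairForm (a * h) ((s.1 : ℤ), s.2)) = R), K s (R'.a, R'.b) := by
      intro R hR
      rw [sum_comm]
      exact sum_le_sum fun R' hR' => step1 R hR R' hR'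
    refine (sum_le_sum e1).trans ?_
    rw [sum_comm]
    refine sum_le_sum fun R' _ => ?_
    rw [← mul_sum]
    refine mul_le_mul_of_nonneg_left (le_of_eq ?_) (pairWt_nonneg _)
    exact sum_fiberwise_of_maps_to (g := fun s : ℕ × ℤ => lrep (pairForm (a * h) ((s.1 : ℤ), s.2)))
      (fun s hs => lrep_pairForm_mem_repsCan ha hh hs) (fun s => K s (R'.a, R'.b))
  -- Step 3: from the canonical representatives to `heegnerReps`
  refine step2.trans ?_
  have step3 : ∑ R' ∈ repsCan a h, pairWt (R', 1) * ∑ s ∈ DP, K s (R'.a, R'.b) ≤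
      ∑ R' ∈ repsCan a h, ∑ s ∈ DP, K s (R'.a, R'.b) := by
    refine sum_le_sum fun R' _ => ?_
    have h0 : 0 ≤ ∑ s ∈ DP, K s (R'.a, R'.b) := sum_nonneg fun s _ => hK0 _ _
    calc pairWt (R', 1) * ∑ s ∈ DP, K s (R'.a, R'.b) ≤ 1 * ∑ s ∈ DP, K s (R'.a, R'.b) :=
          mul_le_mul_of_nonneg_right (pairWt_le_one _) h0
      _ = _ := one_mul _
  refine step3.trans ?_
  have hinj : Set.InjOn (fun R' : BinQF => (R'.a, R'.b)) ↑(repsCan a h) := by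
    intro R hR R' hR' he
    have e1 := (repsCan_pair ha hh hR).2
    have e2 := (repsCan_pair ha hh hR').2
    simp only [] at he
    rw [← e1, ← e2, he]
  have e : ∑ R' ∈ repsCan a h, ∑ s ∈ DP, K s (R'.a, R'.b) =
      ∑ t ∈ (repsCan a h).image (fun R' : BinQF => (R'.a, R'.b)), ∑ s ∈ DP, K s t := by
    rw [sum_image hinj]
  rw [e]
  refine sum_le_sum_of_subset_of_nonneg ?_ (fun t _ _ => sum_nonneg fun s _ => hK0 _ _)
  intro t ht
  obtain ⟨R', hR', rfl⟩ := mem_image.mp ht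
  exact (repsCan_pair ha hh hR').1

end kernelAssembly2

end GM2025

end Literature.NumberTheory.Sieve

end
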